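import Summits.QuantumFields.YangMills.Theorems.BalabanUVNodesN24K1ConsequentOfStubsV19AndChildren
import Literature.MathematicalPhysics.QuantumFieldTheory.Balaban1983to89.Node00.CarriersB8SubBP

/-!
# NODE N24 (B2) IN CLOSING POSITION UNDER V19 WITH N05 ON ITS NON-EMPTY P-SLOT: THE CHILDREN-UNIFORM HYPOTHESIS SPLIT PER CHILD LANE AND THE WORLD BUILT BY N24 — one named, world-free
# hypothesis per in-edge (N05 `B8LeafOfRecordSubBP` · N06 · N07 · N08 · N09 Lemma 4 · N09 Thm 3 · N10 · N11 (S1ᵀ) · N12 · N13 (UV₁₃) · NODE O's positive lower β-bound), the K0 box's UPPER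
# bound discharged HERE, the binding world `w : WorldP` CONSTRUCTED by N24 over the four-pin view of the P-X-PINNED parameter (dag-n05-w4's `XPinned₁₃P`, written out)

TRACK A (YM-PLAN §2d, node N24 of 28 = binder B2 `hB : B16.EndStatementBPrinted D.C`), seat `pub-ymgap-dag-n24-c` (R134 fan-out seat, strategy s2; gen 9, Part 23).  Key of record: K1⁷
`StabilityBAtRecordR13SepCoPH` = stmt-QuantumFields-20542; this file `--supports` it as a helper (Summits lane).  Skeletons of record: K0⁷ V19 (87879403b3a26109), K1⁷ v6 (plan g82,
03:16Z 2026-08-28; stub 1 `stub_nodes13PWS` byte-identical to v5 — §2∕§4 below prove its body's text; stub 2″ in the run currency — Part 24).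
WHY.  (1) Part 19 (`N24K1ConsequentOfStubsV19AndChildren`, p595181) closes K1⁷'s consequent ∕ rung-1 body at `F` from V19's three stub texts and ONE hypothesis `hchildren` — a single
existential over seven residual layers AND a world with fifteen conjuncts; but assembling the world is N24's job (no child lane sees more than one conjunct) and the UPPER β-bound is
ALREADY N24's (the K0 box `hbox'` at the window).  (2) ★ LOCATED-VACUOUS (A6), dag-n05-w4 OBJECTION-H05 ∕ dag-n05-d `B8Prop3ShellModeVacuity.not_b8LeafOfRecordSubBH` (p585094): Part 19's
N05 conjunct — and Parts 14–22's `h05` — read N05 at the H-slot `B8LeafOfRecordSubBH θ₃ lam8`, which is EMPTY at every θ with `2 ≤ θ.D` (typed Prop. 3 reads (1.42) on a class with no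
level-j crossing bond); the live N05 child is the P-slot `B8LeafOfRecordSubBP θ₃ lam8` (dag-n05-w1 `CarriersB8SubBP`, suppliers dag-n05-d D9b∕D9c).  THIS FILE repairs both at once: the
children-uniform hypothesis is SPLIT into eleven independent WORLD-FREE hypotheses (one per lane, each an ∃ over that lane's own objects; N05 ON THE P-SLOT), N24 BUILDS the world —
`C :=` the door's datum, `γ := min γ γ₉ γ₁₁ γ₁₃ γO`, `e₋, e₊ :=` N13's, `β⁺ := β′` (K0's letter), `b :=` NODE O's, `β₀ := 1`, `g_R := 0` (free letters), `L := θ.L = F.L`, `up :=` the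
S-binding over the four-pin view of the P-X-pinned parameter (dag-n05-w4's `XPinned₁₃P θ lam8 lam12 lam13`, WRITTEN OUT — its Node00 module is in flight; the statements never read the pin) — and runs Part 8's X′-GENERIC engine (`N24_stabilityBR13SepCoPH_thetaShape20_rebindXS_fourPin_pointed` ∕
`N24_nodesAtSomeRecordS₁₃SepCoPH_of_rebindXS_fourPin_pointed`) at the P-X-pinned carrier map `X′ᴾ` (= dag-n05-w4's `XPinned₁₃P θ lam8 lam12 lam13`, written out), the guard ∕ `Admissible` ∕ (R₁₃) row discharged at the witness as in Part 10's door.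
§1–§2: general `N`, door letters fixed; §3–§4: `N = 2`, from V19's three stub texts at `F` (Part 19's opening verbatim).
So «WHICH CHILD BLOCKS K1⁷» is ONE NAMED HYPOTHESIS PER LANE, each citable as a TYPE: N05 `h05` (P-slot), N06 `h06`, N07 `h07` (θ-free), N08 `h08` (θ-free), N09 `h09` + `h09T`, N10 `h10`,
N11 `h11`, N12 `h12`, N13 `hUV`, NODE O `hO` (§1∕§3 only — rung 1 needs NO β-positivity), plus V19's three stubs (§3∕§4).  A NEW importing module (imports Part 19 + dag-n05-w1's `Node00.CarriersB8SubBP`).  THEOREMS ONLY, def-free, sorry-free, standard axioms.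

HONEST FRAMING: composition BY NAME; nothing of Bałaban's asserted — the stub texts and the eleven children hypotheses are DISPLAYED; K0⁷ ∕ K1⁷ NOT closed; N24 COMPOSITE — no discharge,
no count moved (5∕27 · A 5∕28), no stub closed; one finite 𝕋⁴ programme at fixed ε; R4 = the conditional finite-𝕋⁴ rung `BalabanLadder.UV` only — NOT continuum ∕ ℝ⁴ ∕ OS ∕ mass gap ∕ Clay.
-/

noncomputable section

open scoped Matrix.Norms.L2Operator BigOperators

namespace Summit.QuantumFields.YangMills.BalabanUVNodes.N24K1OfStubsV19ChildrenSplitWorldBuilt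

open Literature.MathematicalPhysics.QuantumFieldTheory.Balaban1983to89
open Literature.MathematicalPhysics.QuantumFieldTheory.Balaban1983to89.Node00
open DagBinding T4Continuum T4DatumAssembly FlowStepRuns AveragingRT
open FlowStep (BetaLowerH BetaUpperH RGEqH prefixOf)
open Summit.QuantumFields.YangMills.BalabanUVNodes.N07Thm1Top7FromProp8 (variationalThm1RegSepCoP7M_of_prop8TopStep)
open Summit.QuantumFields.YangMills.Theorems.K0PrintCubeOfStepTokensR (gauge9Supplier_of_prop6MemberP)
open Summit.QuantumFields.YangMills.BalabanUVNodes.N24K1ConsequentOfStubsV19AndChildren (windowLetters_of_absBetaBoxH)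

variable {F : T4Family}

/-! ## §1–§2. General `N`, door letters fixed: K1⁷'s consequent and the rung-1 body with the children SPLIT (N05 on the P-slot) and the world BUILT -/

section generalN

variable {N : ℕ} [NeZero N]

/-- **★★★ K1⁷'s θ-KEYED CONSEQUENT AT THE WITNESS `θ₁₅ᶜᶜᴹᵂ(j; γ; ε₀, ε₂₉; B₃, B₃', a₀, a₁)` (general `N`, door letters fixed) FROM ELEVEN WORLD-FREE CHILDREN HYPOTHESES, THE WORLD BUILT HERE,
N05 ON ITS NON-EMPTY P-SLOT** — children: N05 ([B8], ★ P-SLOT): SOME residual [B8] layer carries the SURVIVING leaf over the P-members `B8LeafOfRecordSubBP θ₃ lam8` (dag-n05-w1 `CarriersB8SubBP`; suppliers dag-n05-d D9b∕D9c p596490∕p597296 modulo displayed hypotheses) — NOT the H-slot `B8LeafOfRecordSubBH`, which `B8Prop3ShellModeVacuity.not_b8LeafOfRecordSubBH` (p585094) certifies EMPTY at every θ with `2 ≤ θ.D` (`h05`); N06 ([B9]): SOME operator layer `(M⋆, ops)` carries `B9LeafX (Y9OfRecord …)` (`h06`); N07 ([B11]): SOME residual `ζ` carries `B11Leaf (Z11OfRecord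 F N ζ)` — θ-FREE (`h07`); N08 ([B10]): `PrintedUV3V N F.L` — θ-FREE (`θ₁₅ᶜᶜᴹᵂ.L = F.L`, `rfl`) (`h08`); N09 ([B12] Lemma 4): SOME [B12] residual layer with Lemma 4 on every run (`h09`); N09 ([B12] Thm 3): for SOME coupling threshold `γ₉ > 0`, small couplings ⇒ inductive small-field assumption at EVERY world bound to the door's datum with `w.γ ≤ γ₉` (dag-n09-w2∕w3's junction vocabulary `(hC : w.C = …)`; their all-world doors take `γ₉ := 1`) (`h09T`); N10 ([B13]): SOME run-indexed [B13] residual layer with `B13LeafOfRecord` on every run (`h10`); N11 ([III] (S1ᵀ)): for EVERY ceiling∕floor letter pair `(β⁺, β₀)` the world may carry, SOME coupling threshold `γ₁₁(β⁺, β₀) > 0` such that at EVERY world bound to the door's datum with `w.βup = β⁺`, `w.β₀ = β₀`, `w.γ ≤ γ₁₁`, Part 14's (S1ᵀ) implication holds verbatim (N24 instantiates at its own letters `β⁺ := β′` resp. `B + r`, `β₀ := 1` — so N11 may let its threshold depend on the flow-control constants it is handed) (`h11`); N12 ([B15]): SOME [B15] residual layer with `B15Leaf (WOfRecord₁₃ …)`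 on every run and the selector bound `1 ≤ K → kSel < K` (`h12`); N13 ([III] Cor. 3 ∕ (UV₁₃)): for SOME threshold `γ₁₃ > 0` and SOME exponent functions `e₋, e₊`, the density sandwich on runs with couplings in `]0, γ₁₃]` (`hUV`); NODE O (n25, B3 — print's (2.7) ∕ [III] (0.20) positivity; NOT a Track-A child): SOME `b > 0` bounds the witness's β of record from BELOW on SOME box `]0, γO]` (the world's `0 < w.b` on Part 8's END road; the UPPER bound `w.βup := β′` is K0's box, discharged HERE from `hbox'`) (`hO`).
PROOF.  Open the existentials; `γw := min γ (min γ₉ (min γ₁₁ (min γ₁₃ γO)))`; the world `w := ⟨datum.C, γw, e₋, e₊, β⁺, 1, _, b, _, θ.L, _, 0, up⟩` with `up :=` the S-binding over the FOUR-PIN VIEW OF THE P-X-PINNED PARAMETER `(θᴴ.rebindX X′ᴾ).view₁₃CoPHB10YZW Mstar ops ζ lamW`, `X′ᴾ P := (((θ.res.X P).withB8OfRecordSubBP θ₃ lam8).withB12 (F12OfRecord₁₂ θ₁₂ lam12 P) (lam12 P).consts).withB13OfRecord θ₃ (lam13 P)` — WRITTEN OUT (it is dag-n05-w4's `XPinned₁₃P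 θ lam8 lam12 lam13` ∕ `θᴴ.pinX3P`, `rfl`, whose Node00 module `Record13CarriersXPinnedP` is in flight; no definition introduced here, and nothing in the STATEMENTS reads the pin); binding by `rfl`; guard ∕ `Admissible` ∕ (R₁₃) at the witness BY NAME exactly as in Part 10's door (K0a `ZrUnity.ofHistoryBlind` ∘ `finsum_ζ0_ZrOfRecord₁₃`, dag-n21-c `slotsNondegenerate₁₃_theta13OfThm1CCMW` ∕ `admissible_theta13OfThm1CCMW_of_le_half`, Part 10 §0 `N24_laws₁₃CoPH_theta13OfThm1CCMW`); Part 8's X′-GENERIC engine at `X' := X′ᴾ` (the three sockets — N05's P-slot, N09's Lemma 4 at the [B12] frame of record, N10's [B13] leaf — hold by `rfl`, dag-n05-w4's `socket05S_view₁₃CoPHB10YZW_pinX3P_iff` ∕ `socket09∕10_pinX3P_iff`); `hUV` at `γw` by `B14Cor3.inInterval_of_le`; `h09T`∕`h11` at `(w, rfl)`; `hhi` from `hbox'` and `hlo` from `hO` by `FlowStep.box_mono`; Part 8's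
`N24_stabilityBR13SepCoPH_thetaShape20_rebindXS_fourPin_pointed` BY NAME.  COMPOSITE and CONDITIONAL: every hypothesis displayed; nothing of Bałaban asserted; K0⁷ ∕ K1⁷ NOT closed; no stub closed; no count moved. [cite: Balaban1989LargeFieldII, Thm 1 p.355, (0.1) pp.355–356, p.391; Balaban1988Convergent, Thm 1 p.262, Cor. 3 (2.50) p.264, (3.16)–(3.23) pp.268–270; Balaban1987RG1, Thm 1 p.255, Thm 3 p.264, Lemma 4 p.280, (0.17)–(0.20) pp.255–256, (1.20)–(1.22) p.264; Balaban1985Variational, Thm 1 (8)–(9) p.279, Prop. 8 p.304; Balaban1985RegularSpaces, Lemma 1 p.79 – Thm 8 p.101, Prop. 6 p.99, Thm 8 (1.146) p.101; Balaban1985BackgroundPropagators, Thm 3.1 p.397; Balaban1985UV3, Thm 1 p.257; Balaban1988RG2Cluster, Lemmas 1–3 pp.9–20; Balaban1989LargeFieldI, Prop. 1 p.194 (bookkeeping)] -/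
theorem N24_stabilityBR13SepCoPH_worldBuilt_childrenSplit_theta13OfThm1CCMW_of_gauge9TopStepR_of_betaBoxSignFree_allTorus_door {j c : ℕ} {γ ε₀ ε₂₉ B₃ B₃' a₀ a₁ : ℝ} (hγ₀ : 0 < γ) (hγh : γ ≤ 1 / 2)
    (hε : 0 < ε₀) (hε' : 0 < ε₂₉) (hB : 0 ≤ B₃) (hB' : 0 ≤ B₃') (ha₀ : 0 < a₀) (ha₁ : 0 < a₁)
    (h15 : VariationalThm1RegSepCoP7M F N B₃ a₀ a₁) (hc : c ≤ F.L ^ j)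
    (h9 : Gauge9RegSepTopStepR F N (fun ν K Ω => suppDomOfRecord F ν K Ω) (F.L ^ j) c B₃ B₃' a₀ a₁)
    {bl β' : ℝ} (hbox : BetaLowerH bl γ (betaOfRecord₁₃ F N (theta13OfThm1CCMW F N j γ ε₀ ε₂₉ B₃ B₃' a₀ a₁)))
    (hbox' : BetaUpperH β' γ (betaOfRecord₁₃ F N (theta13OfThm1CCMW F N j γ ε₀ ε₂₉ B₃ B₃' a₀ a₁))) (hl : -bl * γ ^ 2 ≤ 3) (hβ' : β' * γ ^ 2 ≤ 3 / 4)
    (h05 : ∃ lam8 : ResidB8 (theta13OfThm1CCMW F N j γ ε₀ ε₂₉ B₃ B₃' a₀ a₁).toStage3Params, B8LeafOfRecordSubBP (theta13OfThm1CCMW F N j γ ε₀ ε₂₉ B₃ B₃' a₀ a₁).toStage3Params lam8)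
    (h06 : ∃ (Mstar : ℕ) (ops : OpsY N (theta13OfThm1CCMW F N j γ ε₀ ε₂₉ B₃ B₃' a₀ a₁).toStage3Params Mstar), B9LeafX (Y9OfRecord N (theta13OfThm1CCMW F N j γ ε₀ ε₂₉ B₃ B₃' a₀ a₁).toStage3Params Mstar ops))
    (h07 : ∃ ζ : ResidZ F N, B11Leaf (Z11OfRecord F N ζ))
    (h08 : PrintedUV3V N F.L)
    (h09 : ∃ lam12 : ResidB12 F N (theta13OfThm1CCMW F N j γ ε₀ ε₂₉ B₃ B₃' a₀ a₁).τ9.M,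
      ∀ P : B12.RunParams, B12Sec2to5.Lemma4Printed (F12OfRecord₁₂ F N (theta13OfThm1CCMW F N j γ ε₀ ε₂₉ B₃ B₃' a₀ a₁).toStage12Params lam12 P) (lam12 P).consts)
    (h09T : ∃ γ₉ : ℝ, 0 < γ₉ ∧ ∀ w : WorldP, w.C = (datumOfRecord₁₃SepCoPH F N (Stage13HParams.ofHistoryBlind F N ⟨theta13OfThm1CCMW F N j γ ε₀ ε₂₉ B₃ B₃' a₀ a₁, ZrOfRecord₁₃ F N (theta13OfThm1CCMW F N j γ ε₀ ε₂₉ B₃ B₃' a₀ a₁)⟩) (N24_provisos₁₃SepCoPH_door_theta13OfThm1CCMW_of_gauge9TopStepR_of_betaBoxSignFree_allTorus hγ₀ hγh hε hε' hB hB' ha₀ ha₁ h15 hc h9 hbox hbox' hl hβ')).C →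
      w.γ ≤ γ₉ → ∀ P : B12.RunParams, (leavesP w P).smallCouplings → (leavesP w P).smallFieldInductive)
    (h10 : ∃ lam13 : B12.RunParams → ResidB13 (theta13OfThm1CCMW F N j γ ε₀ ε₂₉ B₃ B₃' a₀ a₁).toStage3Params,
      ∀ P : B12.RunParams, B13LeafOfRecord (theta13OfThm1CCMW F N j γ ε₀ ε₂₉ B₃ B₃' a₀ a₁).toStage3Params (lam13 P))
    (h11 : ∀ βup β₀ : ℝ, ∃ γ₁₁ : ℝ, 0 < γ₁₁ ∧ ∀ w : WorldP, w.C = (datumOfRecord₁₃SepCoPH F N (Stage13HParams.ofHistoryBlind F N ⟨theta13OfThm1CCMW F N j γ ε₀ ε₂₉ B₃ B₃' a₀ a₁, ZrOfRecord₁₃ F N (theta13OfThm1CCMW F N j γ ε₀ ε₂₉ B₃ B₃' a₀ a₁)⟩) (N24_provisos₁₃SepCoPH_door_theta13OfThm1CCMW_of_gauge9TopStepR_of_betaBoxSignFree_allTorus hγ₀ hγh hε hε' hB hB' ha₀ ha₁ h15 hc h9 hbox hbox' hl hβ')).C →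
      w.βup = βup → w.β₀ = β₀ → w.γ ≤ γ₁₁ → ∀ P : B12.RunParams, (leavesP w P).b7 → (leavesP w P).b8 → (leavesP w P).b9 → (leavesP w P).b10 → (leavesP w P).b11 →
      (leavesP w P).smallCouplings → (leavesP w P).smallFieldInductive → (leavesP w P).flowControl →
        ∀ k, k < P.K → SLaw₁₃CoPH F N (Stage13HParams.ofHistoryBlind F N ⟨theta13OfThm1CCMW F N j γ ε₀ ε₂₉ B₃ B₃' a₀ a₁, ZrOfRecord₁₃ F N (theta13OfThm1CCMW F N j γ ε₀ ε₂₉ B₃ B₃' a₀ a₁)⟩) P k → TLaw₁₃CoPH F N (Stage13HParams.ofHistoryBlind F N ⟨theta13OfThm1CCMW F N j γ ε₀ ε₂₉ B₃ B₃' a₀ a₁, ZrOfRecord₁₃ F N (theta13OfThm1CCMW F N j γ ε₀ ε₂₉ B₃ B₃' a₀ a₁)⟩) P k)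
    (h12 : ∃ lamW : ResidW F N, (∀ P : B12.RunParams, B15Leaf (WOfRecord₁₃ F N (theta13OfThm1CCMW F N j γ ε₀ ε₂₉ B₃ B₃' a₀ a₁) lamW P)) ∧
      ∀ P : B12.RunParams, 1 ≤ P.K → lamW.kSel P < P.K)
    (hUV : ∃ γ₁₃ : ℝ, 0 < γ₁₃ ∧ ∃ em ep : ℝ → ℝ, ∀ P : B12.RunParams, (genFlow (betaOfRecord₁₃ F N (theta13OfThm1CCMW F N j γ ε₀ ε₂₉ B₃ B₃' a₀ a₁)) P.g0).InInterval γ₁₃ P.K → ∀ k, k ≤ P.K → SLaw₁₃CoPH F N (Stage13HParams.ofHistoryBlind F N ⟨theta13OfThm1CCMW F N j γ ε₀ ε₂₉ B₃ B₃' a₀ a₁, ZrOfRecord₁₃ F N (theta13OfThm1CCMW F N j γ ε₀ ε₂₉ B₃ B₃' a₀ a₁)⟩) P k →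
      ∀ U : GaugeField (F.P P.K) k (SU N),
        chiβOfRecord₁₃ F N (theta13OfThm1CCMW F N j γ ε₀ ε₂₉ B₃ B₃' a₀ a₁) P.K (gOfRecord₁₃ F N (theta13OfThm1CCMW F N j γ ε₀ ε₂₉ B₃ B₃' a₀ a₁) P) k U *
              Real.exp (-(1 / (gOfRecord₁₃ F N (theta13OfThm1CCMW F N j γ ε₀ ε₂₉ B₃ B₃' a₀ a₁) P k) ^ 2 * wilsonBGOfRecord F N (theta13OfThm1CCMW F N j γ ε₀ ε₂₉ B₃ B₃' a₀ a₁).εbg P k U)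
                - em (gOfRecord₁₃ F N (theta13OfThm1CCMW F N j γ ε₀ ε₂₉ B₃ B₃' a₀ a₁) P k) * (Fintype.card (Site (F.P P.K) k) : ℝ)) ≤ densOfRecord₁₃ F N (theta13OfThm1CCMW F N j γ ε₀ ε₂₉ B₃ B₃' a₀ a₁) P k U ∧
        densOfRecord₁₃ F N (theta13OfThm1CCMW F N j γ ε₀ ε₂₉ B₃ B₃' a₀ a₁) P k U ≤ Real.exp (ep (gOfRecord₁₃ F N (theta13OfThm1CCMW F N j γ ε₀ ε₂₉ B₃ B₃' a₀ a₁) P k) * (Fintype.card (Site (F.P P.K) k) : ℝ)))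
    (hO : ∃ b : ℝ, 0 < b ∧ ∃ γO : ℝ, 0 < γO ∧ BetaLowerH b γO (betaOfRecord₁₃ F N (theta13OfThm1CCMW F N j γ ε₀ ε₂₉ B₃ B₃' a₀ a₁))) :
    ∃ (θ' : Stage13HParams F N) (h' : θ'.Provisos₁₃SepCoPH F N), (θ'.ZhUnity F N ∧ θ'.SlotsNondegenerate₁₃ F N) ∧ θ'.Admissible F N ∧
      B16.EndStatementBPrinted (datumOfRecord₁₃SepCoPH F N θ' h').C ∧
      ∃ γ₁ : ℝ, 0 < γ₁ ∧ ∀ γ : ℝ, 0 < γ → γ ≤ γ₁ → ∃ P : B12.RunParams, 1 ≤ P.K ∧ ((datumOfRecord₁₃SepCoPH F N θ' h').C P).flow.InInterval γ P.K := by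
  obtain ⟨lam8, h05⟩ := h05
  obtain ⟨Mstar, ops, h06⟩ := h06
  obtain ⟨ζ, h07⟩ := h07
  obtain ⟨lam12, h09⟩ := h09
  obtain ⟨lam13, h10⟩ := h10
  obtain ⟨γ₉, hγ₉, h09T⟩ := h09T
  obtain ⟨γ₁₁, hγ₁₁, h11⟩ := h11 β' 1
  obtain ⟨lamW, h12, -⟩ := h12
  obtain ⟨γ₁₃, hγ₁₃, em, ep, hUV⟩ := hUV
  obtain ⟨b, hb, γO, hγO, hO⟩ := hO
  have hL1 : (1 : ℝ) < ((theta13OfThm1CCMW F N j γ ε₀ ε₂₉ B₃ B₃' a₀ a₁).L : ℝ) := by exact_mod_cast F.hL.2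
  have hγw0 : 0 < min γ (min γ₉ (min γ₁₁ (min γ₁₃ γO))) := lt_min hγ₀ (lt_min hγ₉ (lt_min hγ₁₁ (lt_min hγ₁₃ hγO)))
  have hγwγ : min γ (min γ₉ (min γ₁₁ (min γ₁₃ γO))) ≤ γ := min_le_left _ _
  have hγw9 : min γ (min γ₉ (min γ₁₁ (min γ₁₃ γO))) ≤ γ₉ := (min_le_right _ _).trans (min_le_left _ _)
  have hγw11 : min γ (min γ₉ (min γ₁₁ (min γ₁₃ γO))) ≤ γ₁₁ := (min_le_right _ _).trans ((min_le_right _ _).trans (min_le_left _ _))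
  have hγw13 : min γ (min γ₉ (min γ₁₁ (min γ₁₃ γO))) ≤ γ₁₃ := (min_le_right _ _).trans ((min_le_right _ _).trans ((min_le_right _ _).trans (min_le_left _ _)))
  have hγwO : min γ (min γ₉ (min γ₁₁ (min γ₁₃ γO))) ≤ γO := (min_le_right _ _).trans ((min_le_right _ _).trans ((min_le_right _ _).trans (min_le_right _ _)))
  set γw : ℝ := min γ (min γ₉ (min γ₁₁ (min γ₁₃ γO)))
  let w : WorldP :=
    { C := (datumOfRecord₁₃SepCoPH F N (Stage13HParams.ofHistoryBlind F N ⟨theta13OfThm1CCMW F N j γ ε₀ ε₂₉ B₃ B₃' a₀ a₁, ZrOfRecord₁₃ F N (theta13OfThm1CCMW F N j γ ε₀ ε₂₉ B₃ B₃' a₀ a₁)⟩) (N24_provisos₁₃SepCoPH_door_theta13OfThm1CCMW_of_gauge9TopStepR_of_betaBoxSignFree_allTorus hγ₀ hγh hε hε' hB hB' ha₀ ha₁ h15 hc h9 hbox hbox' hl hβ')).C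
      γ := γw, em := em, ep := ep, βup := β', β₀ := 1, β₀_pos := one_pos, b := b, b_pos := hb
      L := ((theta13OfThm1CCMW F N j γ ε₀ ε₂₉ B₃ B₃' a₀ a₁).L : ℝ), one_lt_L := hL1, gR := 0
      up := upOfRecord₅CS F N (((Stage13HParams.ofHistoryBlind F N ⟨theta13OfThm1CCMW F N j γ ε₀ ε₂₉ B₃ B₃' a₀ a₁, ZrOfRecord₁₃ F N (theta13OfThm1CCMW F N j γ ε₀ ε₂₉ B₃ B₃' a₀ a₁)⟩).rebindX F N (fun P : B12.RunParams => (((((theta13OfThm1CCMW F N j γ ε₀ ε₂₉ B₃ B₃' a₀ a₁).res.X P).withB8OfRecordSubBP (theta13OfThm1CCMW F N j γ ε₀ ε₂₉ B₃ B₃' a₀ a₁).toStage3Params lam8).withB12 (F12OfRecord₁₂ F N (theta13OfThm1CCMW F N j γ ε₀ ε₂₉ B₃ B₃' a₀ a₁).toStage12Params lam12 P) (lam12 P).consts).withB13OfRecord (theta13OfThm1CCMW F N j γ ε₀ ε₂₉ B₃ B₃' a₀ a₁).toStage3Params (lam13 P)))).view₁₃CoPHB10YZW F N Mstar ops ζ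 lamW) }
  have hC : w.C = (datumOfRecord₁₃SepCoPH F N (Stage13HParams.ofHistoryBlind F N ⟨theta13OfThm1CCMW F N j γ ε₀ ε₂₉ B₃ B₃' a₀ a₁, ZrOfRecord₁₃ F N (theta13OfThm1CCMW F N j γ ε₀ ε₂₉ B₃ B₃' a₀ a₁)⟩) (N24_provisos₁₃SepCoPH_door_theta13OfThm1CCMW_of_gauge9TopStepR_of_betaBoxSignFree_allTorus hγ₀ hγh hε hε' hB hB' ha₀ ha₁ h15 hc h9 hbox hbox' hl hβ')).C := rfl
  have hθ := admissible_theta13OfThm1CCMW_of_le_half F N hγ₀ hγh hε hε' hB hB' ha₀ ha₁ (j := j) (ε₀ := ε₀) (ε₂₉ := ε₂₉)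
  have hU : (Stage13HParams.ofHistoryBlind F N ⟨theta13OfThm1CCMW F N j γ ε₀ ε₂₉ B₃ B₃' a₀ a₁, ZrOfRecord₁₃ F N (theta13OfThm1CCMW F N j γ ε₀ ε₂₉ B₃ B₃' a₀ a₁)⟩).ZhUnity F N ∧ (Stage13HParams.ofHistoryBlind F N ⟨theta13OfThm1CCMW F N j γ ε₀ ε₂₉ B₃ B₃' a₀ a₁, ZrOfRecord₁₃ F N (theta13OfThm1CCMW F N j γ ε₀ ε₂₉ B₃ B₃' a₀ a₁)⟩).SlotsNondegenerate₁₃ F N :=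
    ⟨(Stage13RParams.ZrUnity.ofHistoryBlind (θ := ⟨theta13OfThm1CCMW F N j γ ε₀ ε₂₉ B₃ B₃' a₀ a₁, ZrOfRecord₁₃ F N (theta13OfThm1CCMW F N j γ ε₀ ε₂₉ B₃ B₃' a₀ a₁)⟩)
      fun p i ω => finsum_ζ0_ZrOfRecord₁₃ (θ := theta13OfThm1CCMW F N j γ ε₀ ε₂₉ B₃ B₃' a₀ a₁) (p := p) i ω),
     slotsNondegenerate₁₃_theta13OfThm1CCMW F N j γ ε₀ ε₂₉ B₃ B₃' a₀ a₁⟩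
  have hlaws : ∀ (P : B12.RunParams) (k : ℕ), k < P.K → TLaw₁₃CoPH F N (Stage13HParams.ofHistoryBlind F N ⟨theta13OfThm1CCMW F N j γ ε₀ ε₂₉ B₃ B₃' a₀ a₁, ZrOfRecord₁₃ F N (theta13OfThm1CCMW F N j γ ε₀ ε₂₉ B₃ B₃' a₀ a₁)⟩) P k → SLaw₁₃CoPH F N (Stage13HParams.ofHistoryBlind F N ⟨theta13OfThm1CCMW F N j γ ε₀ ε₂₉ B₃ B₃' a₀ a₁, ZrOfRecord₁₃ F N (theta13OfThm1CCMW F N j γ ε₀ ε₂₉ B₃ B₃' a₀ a₁)⟩) P (k + 1) := fun P =>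
    N24_laws₁₃CoPH_theta13OfThm1CCMW (ZrOfRecord₁₃ F N (theta13OfThm1CCMW F N j γ ε₀ ε₂₉ B₃ B₃' a₀ a₁)) (fun p _ _ _ => ZrOfRecord₁₃ F N (theta13OfThm1CCMW F N j γ ε₀ ε₂₉ B₃ B₃' a₀ a₁) p) (fun p _ _ _ => ((theta13OfThm1CCMW F N j γ ε₀ ε₂₉ B₃ B₃' a₀ a₁).Rz p.K).phi) P hγ₀ hγh hε hε' hB hB' ha₀ ha₁
  have hUVw : ∀ P : B12.RunParams, (genFlow (betaOfRecord₁₃ F N (Stage13HParams.ofHistoryBlind F N ⟨theta13OfThm1CCMW F N j γ ε₀ ε₂₉ B₃ B₃' a₀ a₁, ZrOfRecord₁₃ F N (theta13OfThm1CCMW F N j γ ε₀ ε₂₉ B₃ B₃' a₀ a₁)⟩).toStage13Params) P.g0).InInterval w.γ P.K → ∀ k, k ≤ P.K → SLaw₁₃CoPH F N (Stage13HParams.ofHistoryBlind F N ⟨theta13OfThm1CCMW F N j γ ε₀ ε₂₉ B₃ B₃' a₀ a₁, ZrOfRecord₁₃ F N (theta13OfThm1CCMW F N j γ ε₀ ε₂₉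 B₃ B₃' a₀ a₁)⟩) P k →
      ∀ U : GaugeField (F.P P.K) k (SU N),
        chiβOfRecord₁₃ F N (Stage13HParams.ofHistoryBlind F N ⟨theta13OfThm1CCMW F N j γ ε₀ ε₂₉ B₃ B₃' a₀ a₁, ZrOfRecord₁₃ F N (theta13OfThm1CCMW F N j γ ε₀ ε₂₉ B₃ B₃' a₀ a₁)⟩).toStage13Params P.K (gOfRecord₁₃ F N (Stage13HParams.ofHistoryBlind F N ⟨theta13OfThm1CCMW F N j γ ε₀ ε₂₉ B₃ B₃' a₀ a₁, ZrOfRecord₁₃ F N (theta13OfThm1CCMW F N j γ ε₀ ε₂₉ B₃ B₃' a₀ a₁)⟩).toStage13Params P) k U *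
              Real.exp (-(1 / (gOfRecord₁₃ F N (Stage13HParams.ofHistoryBlind F N ⟨theta13OfThm1CCMW F N j γ ε₀ ε₂₉ B₃ B₃' a₀ a₁, ZrOfRecord₁₃ F N (theta13OfThm1CCMW F N j γ ε₀ ε₂₉ B₃ B₃' a₀ a₁)⟩).toStage13Params P k) ^ 2 * wilsonBGOfRecord F N (Stage13HParams.ofHistoryBlind F N ⟨theta13OfThm1CCMW F N j γ ε₀ ε₂₉ B₃ B₃' a₀ a₁, ZrOfRecord₁₃ F N (theta13OfThm1CCMW F N j γ ε₀ ε₂₉ B₃ B₃' a₀ a₁)⟩).εbg P k U)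
                - w.em (gOfRecord₁₃ F N (Stage13HParams.ofHistoryBlind F N ⟨theta13OfThm1CCMW F N j γ ε₀ ε₂₉ B₃ B₃' a₀ a₁, ZrOfRecord₁₃ F N (theta13OfThm1CCMW F N j γ ε₀ ε₂₉ B₃ B₃' a₀ a₁)⟩).toStage13Params P k) * (Fintype.card (Site (F.P P.K) k) : ℝ)) ≤ densOfRecord₁₃ F N (Stage13HParams.ofHistoryBlind F N ⟨theta13OfThm1CCMW F N j γ ε₀ ε₂₉ B₃ B₃' a₀ a₁, ZrOfRecord₁₃ F N (theta13OfThm1CCMW F N j γ ε₀ ε₂₉ B₃ B₃' a₀ a₁)⟩).toStage13Params P k U ∧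
        densOfRecord₁₃ F N (Stage13HParams.ofHistoryBlind F N ⟨theta13OfThm1CCMW F N j γ ε₀ ε₂₉ B₃ B₃' a₀ a₁, ZrOfRecord₁₃ F N (theta13OfThm1CCMW F N j γ ε₀ ε₂₉ B₃ B₃' a₀ a₁)⟩).toStage13Params P k U ≤ Real.exp (w.ep (gOfRecord₁₃ F N (Stage13HParams.ofHistoryBlind F N ⟨theta13OfThm1CCMW F N j γ ε₀ ε₂₉ B₃ B₃' a₀ a₁, ZrOfRecord₁₃ F N (theta13OfThm1CCMW F N j γ ε₀ ε₂₉ B₃ B₃' a₀ a₁)⟩).toStage13Params P k) * (Fintype.card (Site (F.P P.K) k) : ℝ)) :=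
    fun P hI k hk hS U => hUV P (B14Cor3.inInterval_of_le hI hγw13) k hk hS U
  exact N24_stabilityBR13SepCoPH_thetaShape20_rebindXS_fourPin_pointed (Stage13HParams.ofHistoryBlind F N ⟨theta13OfThm1CCMW F N j γ ε₀ ε₂₉ B₃ B₃' a₀ a₁, ZrOfRecord₁₃ F N (theta13OfThm1CCMW F N j γ ε₀ ε₂₉ B₃ B₃' a₀ a₁)⟩) (N24_provisos₁₃SepCoPH_door_theta13OfThm1CCMW_of_gauge9TopStepR_of_betaBoxSignFree_allTorus hγ₀ hγh hε hε' hB hB' ha₀ ha₁ h15 hc h9 hbox hbox' hl hβ') hθ hU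
    (fun P : B12.RunParams => (((((theta13OfThm1CCMW F N j γ ε₀ ε₂₉ B₃ B₃' a₀ a₁).res.X P).withB8OfRecordSubBP (theta13OfThm1CCMW F N j γ ε₀ ε₂₉ B₃ B₃' a₀ a₁).toStage3Params lam8).withB12 (F12OfRecord₁₂ F N (theta13OfThm1CCMW F N j γ ε₀ ε₂₉ B₃ B₃' a₀ a₁).toStage12Params lam12 P) (lam12 P).consts).withB13OfRecord (theta13OfThm1CCMW F N j γ ε₀ ε₂₉ B₃ B₃' a₀ a₁).toStage3Params (lam13 P))) Mstar ops ζ lamW w hC ⟨hγw0, hγwγ⟩ rfl (fun P => rfl)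
    (fun P => h05) h06 h07 h08 (fun P => h09 P) (h09T w hC hγw9) (fun P _ _ _ _ => h10 P) (h11 w hC rfl rfl hγw11) h12 hlaws hUVw
    (fun k v hv => hO k v (FlowStep.box_mono hγwO k hv)) (fun k v hv => hbox' k v (FlowStep.box_mono hγwγ k hv))

/-- **★★ RUNG 1's BODY (`NodesAtSomeRecord13PWS`'s text, general `N`; K1⁷ v5∕v6 stub 1 unchanged) AT THE WITNESS, door letters fixed, FROM TEN WORLD-FREE CHILDREN HYPOTHESES, THE WORLD BUILT HERE,
N05 ON ITS P-SLOT** — children as in §1 (`h05 … hUV`; `h12` carries the selector bound); NO β-box on this rung: NODE O's `hO` is NOT a hypothesis (`b := 1`, `β⁺ := β′` free letters).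
PROOF as in §1 with `γw := min γ (min γ₉ (min γ₁₁ γ₁₃))` and Part 8's `N24_nodesAtSomeRecordS₁₃SepCoPH_of_rebindXS_fourPin_pointed`.  COMPOSITE and CONDITIONAL: every hypothesis displayed; nothing of Bałaban asserted; K0⁷ ∕ K1⁷ NOT closed; no stub closed; no count moved. [cite: Balaban1989LargeFieldII, Thm 1 p.355, (0.1) pp.355–356, p.391; Balaban1988Convergent, Thm 1 p.262, Cor. 3 (2.50) p.264, (3.16)–(3.23) pp.268–270; Balaban1987RG1, Thm 1 p.255, Thm 3 p.264, Lemma 4 p.280, (0.17)–(0.20) pp.255–256, (1.20)–(1.22) p.264; Balaban1985Variational, Thm 1 (8)–(9) p.279, Prop. 8 p.304; Balaban1985RegularSpaces, Lemma 1 p.79 – Thm 8 p.101, Prop. 6 p.99, Thm 8 (1.146) p.101; Balaban1985BackgroundPropagators, Thm 3.1 p.397; Balaban1985UV3, Thm 1 p.257; Balaban1988RG2Cluster, Lemmas 1–3 pp.9–20; Balaban1989LargeFieldI, Prop. 1 p.194 (bookkeeping)] -/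
theorem N24_nodesAtSomeRecordS₁₃SepCoPH_worldBuilt_childrenSplit_theta13OfThm1CCMW_of_gauge9TopStepR_of_betaBoxSignFree_allTorus_door {j c : ℕ} {γ ε₀ ε₂₉ B₃ B₃' a₀ a₁ : ℝ} (hγ₀ : 0 < γ) (hγh : γ ≤ 1 / 2)
    (hε : 0 < ε₀) (hε' : 0 < ε₂₉) (hB : 0 ≤ B₃) (hB' : 0 ≤ B₃') (ha₀ : 0 < a₀) (ha₁ : 0 < a₁)
    (h15 : VariationalThm1RegSepCoP7M F N B₃ a₀ a₁) (hc : c ≤ F.L ^ j)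
    (h9 : Gauge9RegSepTopStepR F N (fun ν K Ω => suppDomOfRecord F ν K Ω) (F.L ^ j) c B₃ B₃' a₀ a₁)
    {bl β' : ℝ} (hbox : BetaLowerH bl γ (betaOfRecord₁₃ F N (theta13OfThm1CCMW F N j γ ε₀ ε₂₉ B₃ B₃' a₀ a₁)))
    (hbox' : BetaUpperH β' γ (betaOfRecord₁₃ F N (theta13OfThm1CCMW F N j γ ε₀ ε₂₉ B₃ B₃' a₀ a₁))) (hl : -bl * γ ^ 2 ≤ 3) (hβ' : β' * γ ^ 2 ≤ 3 / 4)
    (h05 : ∃ lam8 : ResidB8 (theta13OfThm1CCMW F N j γ ε₀ ε₂₉ B₃ B₃' a₀ a₁).toStage3Params, B8LeafOfRecordSubBP (theta13OfThm1CCMW F N j γ ε₀ ε₂₉ B₃ B₃' a₀ a₁).toStage3Params lam8)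
    (h06 : ∃ (Mstar : ℕ) (ops : OpsY N (theta13OfThm1CCMW F N j γ ε₀ ε₂₉ B₃ B₃' a₀ a₁).toStage3Params Mstar), B9LeafX (Y9OfRecord N (theta13OfThm1CCMW F N j γ ε₀ ε₂₉ B₃ B₃' a₀ a₁).toStage3Params Mstar ops))
    (h07 : ∃ ζ : ResidZ F N, B11Leaf (Z11OfRecord F N ζ))
    (h08 : PrintedUV3V N F.L)
    (h09 : ∃ lam12 : ResidB12 F N (theta13OfThm1CCMW F N j γ ε₀ ε₂₉ B₃ B₃' a₀ a₁).τ9.M,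
      ∀ P : B12.RunParams, B12Sec2to5.Lemma4Printed (F12OfRecord₁₂ F N (theta13OfThm1CCMW F N j γ ε₀ ε₂₉ B₃ B₃' a₀ a₁).toStage12Params lam12 P) (lam12 P).consts)
    (h09T : ∃ γ₉ : ℝ, 0 < γ₉ ∧ ∀ w : WorldP, w.C = (datumOfRecord₁₃SepCoPH F N (Stage13HParams.ofHistoryBlind F N ⟨theta13OfThm1CCMW F N j γ ε₀ ε₂₉ B₃ B₃' a₀ a₁, ZrOfRecord₁₃ F N (theta13OfThm1CCMW F N j γ ε₀ ε₂₉ B₃ B₃' a₀ a₁)⟩) (N24_provisos₁₃SepCoPH_door_theta13OfThm1CCMW_of_gauge9TopStepR_of_betaBoxSignFree_allTorus hγ₀ hγh hε hε' hB hB' ha₀ ha₁ h15 hc h9 hbox hbox' hl hβ')).C →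
      w.γ ≤ γ₉ → ∀ P : B12.RunParams, (leavesP w P).smallCouplings → (leavesP w P).smallFieldInductive)
    (h10 : ∃ lam13 : B12.RunParams → ResidB13 (theta13OfThm1CCMW F N j γ ε₀ ε₂₉ B₃ B₃' a₀ a₁).toStage3Params,
      ∀ P : B12.RunParams, B13LeafOfRecord (theta13OfThm1CCMW F N j γ ε₀ ε₂₉ B₃ B₃' a₀ a₁).toStage3Params (lam13 P))
    (h11 : ∀ βup β₀ : ℝ, ∃ γ₁₁ : ℝ, 0 < γ₁₁ ∧ ∀ w : WorldP, w.C = (datumOfRecord₁₃SepCoPH F N (Stage13HParams.ofHistoryBlind F N ⟨theta13OfThm1CCMW F N j γ ε₀ ε₂₉ B₃ B₃' a₀ a₁, ZrOfRecord₁₃ F N (theta13OfThm1CCMW F N j γ ε₀ ε₂₉ B₃ B₃' a₀ a₁)⟩) (N24_provisos₁₃SepCoPH_door_theta13OfThm1CCMW_of_gauge9TopStepR_of_betaBoxSignFree_allTorus hγ₀ hγh hε hε' hB hB' ha₀ ha₁ h15 hc h9 hbox hbox' hl hβ')).C →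
      w.βup = βup → w.β₀ = β₀ → w.γ ≤ γ₁₁ → ∀ P : B12.RunParams, (leavesP w P).b7 → (leavesP w P).b8 → (leavesP w P).b9 → (leavesP w P).b10 → (leavesP w P).b11 →
      (leavesP w P).smallCouplings → (leavesP w P).smallFieldInductive → (leavesP w P).flowControl →
        ∀ k, k < P.K → SLaw₁₃CoPH F N (Stage13HParams.ofHistoryBlind F N ⟨theta13OfThm1CCMW F N j γ ε₀ ε₂₉ B₃ B₃' a₀ a₁, ZrOfRecord₁₃ F N (theta13OfThm1CCMW F N j γ ε₀ ε₂₉ B₃ B₃' a₀ a₁)⟩) P k → TLaw₁₃CoPH F N (Stage13HParams.ofHistoryBlind F N ⟨theta13OfThm1CCMW F N j γ ε₀ ε₂₉ B₃ B₃' a₀ a₁, ZrOfRecord₁₃ F N (theta13OfThm1CCMW F N j γ ε₀ ε₂₉ B₃ B₃' a₀ a₁)⟩) P k)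
    (h12 : ∃ lamW : ResidW F N, (∀ P : B12.RunParams, B15Leaf (WOfRecord₁₃ F N (theta13OfThm1CCMW F N j γ ε₀ ε₂₉ B₃ B₃' a₀ a₁) lamW P)) ∧
      ∀ P : B12.RunParams, 1 ≤ P.K → lamW.kSel P < P.K)
    (hUV : ∃ γ₁₃ : ℝ, 0 < γ₁₃ ∧ ∃ em ep : ℝ → ℝ, ∀ P : B12.RunParams, (genFlow (betaOfRecord₁₃ F N (theta13OfThm1CCMW F N j γ ε₀ ε₂₉ B₃ B₃' a₀ a₁)) P.g0).InInterval γ₁₃ P.K → ∀ k, k ≤ P.K → SLaw₁₃CoPH F N (Stage13HParams.ofHistoryBlind F N ⟨theta13OfThm1CCMW F N j γ ε₀ ε₂₉ B₃ B₃' a₀ a₁, ZrOfRecord₁₃ F N (theta13OfThm1CCMW F N j γ ε₀ ε₂₉ B₃ B₃' a₀ a₁)⟩) P k →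
      ∀ U : GaugeField (F.P P.K) k (SU N),
        chiβOfRecord₁₃ F N (theta13OfThm1CCMW F N j γ ε₀ ε₂₉ B₃ B₃' a₀ a₁) P.K (gOfRecord₁₃ F N (theta13OfThm1CCMW F N j γ ε₀ ε₂₉ B₃ B₃' a₀ a₁) P) k U *
              Real.exp (-(1 / (gOfRecord₁₃ F N (theta13OfThm1CCMW F N j γ ε₀ ε₂₉ B₃ B₃' a₀ a₁) P k) ^ 2 * wilsonBGOfRecord F N (theta13OfThm1CCMW F N j γ ε₀ ε₂₉ B₃ B₃' a₀ a₁).εbg P k U)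
                - em (gOfRecord₁₃ F N (theta13OfThm1CCMW F N j γ ε₀ ε₂₉ B₃ B₃' a₀ a₁) P k) * (Fintype.card (Site (F.P P.K) k) : ℝ)) ≤ densOfRecord₁₃ F N (theta13OfThm1CCMW F N j γ ε₀ ε₂₉ B₃ B₃' a₀ a₁) P k U ∧
        densOfRecord₁₃ F N (theta13OfThm1CCMW F N j γ ε₀ ε₂₉ B₃ B₃' a₀ a₁) P k U ≤ Real.exp (ep (gOfRecord₁₃ F N (theta13OfThm1CCMW F N j γ ε₀ ε₂₉ B₃ B₃' a₀ a₁) P k) * (Fintype.card (Site (F.P P.K) k) : ℝ))) :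
    ∃ (θ : Stage13HParams F N) (hP : θ.Provisos₁₃SepCoPH F N) (w : WorldP), (θ.ZhUnity F N ∧ θ.SlotsNondegenerate₁₃ F N) ∧ θ.Admissible F N ∧
      (∃ (θ' : Stage13HParams F N) (h' : θ'.Provisos₁₃SepCoPH F N), θ'.Admissible F N ∧
      datumOfRecord₁₃SepCoPH F N θ hP = datumOfRecord₁₃SepCoPH F N θ' h' ∧ w.C = (datumOfRecord₁₃SepCoPH F N θ hP).C ∧ (0 < w.γ ∧ w.γ ≤ θ'.γ) ∧
      w.L = (θ'.L : ℝ) ∧ ∀ P : B12.RunParams, w.up P = upOfRecord₅CS F N (θ'.toStage5₁₃CoPH F N) P) ∧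
      (∀ P : B12.RunParams, Nodes (leavesP w P)) ∧ PrintedUV3V N θ.L ∧
      ∃ lam : ResidW F N, (∀ P : B12.RunParams, 1 ≤ P.K → lam.kSel P < P.K) ∧
        ∀ P : B12.RunParams, lam.kSel P < P.K → ((leavesP w P).rBasicStep ↔ B15Leaf (WOfRecord₁₃ F N θ.toStage13Params lam P)) := by
  obtain ⟨lam8, h05⟩ := h05
  obtain ⟨Mstar, ops, h06⟩ := h06
  obtain ⟨ζ, h07⟩ := h07
  obtain ⟨lam12, h09⟩ := h09
  obtain ⟨lam13, h10⟩ := h10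
  obtain ⟨γ₉, hγ₉, h09T⟩ := h09T
  obtain ⟨γ₁₁, hγ₁₁, h11⟩ := h11 β' 1
  obtain ⟨lamW, h12, hK⟩ := h12
  obtain ⟨γ₁₃, hγ₁₃, em, ep, hUV⟩ := hUV
  have hL1 : (1 : ℝ) < ((theta13OfThm1CCMW F N j γ ε₀ ε₂₉ B₃ B₃' a₀ a₁).L : ℝ) := by exact_mod_cast F.hL.2
  have hγw0 : 0 < min γ (min γ₉ (min γ₁₁ γ₁₃)) := lt_min hγ₀ (lt_min hγ₉ (lt_min hγ₁₁ hγ₁₃))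
  have hγwγ : min γ (min γ₉ (min γ₁₁ γ₁₃)) ≤ γ := min_le_left _ _
  have hγw9 : min γ (min γ₉ (min γ₁₁ γ₁₃)) ≤ γ₉ := (min_le_right _ _).trans (min_le_left _ _)
  have hγw11 : min γ (min γ₉ (min γ₁₁ γ₁₃)) ≤ γ₁₁ := (min_le_right _ _).trans ((min_le_right _ _).trans (min_le_left _ _))
  have hγw13 : min γ (min γ₉ (min γ₁₁ γ₁₃)) ≤ γ₁₃ := (min_le_right _ _).trans ((min_le_right _ _).trans (min_le_right _ _))
  set γw : ℝ := min γ (min γ₉ (min γ₁₁ γ₁₃))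
  let w : WorldP :=
    { C := (datumOfRecord₁₃SepCoPH F N (Stage13HParams.ofHistoryBlind F N ⟨theta13OfThm1CCMW F N j γ ε₀ ε₂₉ B₃ B₃' a₀ a₁, ZrOfRecord₁₃ F N (theta13OfThm1CCMW F N j γ ε₀ ε₂₉ B₃ B₃' a₀ a₁)⟩) (N24_provisos₁₃SepCoPH_door_theta13OfThm1CCMW_of_gauge9TopStepR_of_betaBoxSignFree_allTorus hγ₀ hγh hε hε' hB hB' ha₀ ha₁ h15 hc h9 hbox hbox' hl hβ')).C
      γ := γw, em := em, ep := ep, βup := β', β₀ := 1, β₀_pos := one_pos, b := 1, b_pos := one_pos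
      L := ((theta13OfThm1CCMW F N j γ ε₀ ε₂₉ B₃ B₃' a₀ a₁).L : ℝ), one_lt_L := hL1, gR := 0
      up := upOfRecord₅CS F N (((Stage13HParams.ofHistoryBlind F N ⟨theta13OfThm1CCMW F N j γ ε₀ ε₂₉ B₃ B₃' a₀ a₁, ZrOfRecord₁₃ F N (theta13OfThm1CCMW F N j γ ε₀ ε₂₉ B₃ B₃' a₀ a₁)⟩).rebindX F N (fun P : B12.RunParams => (((((theta13OfThm1CCMW F N j γ ε₀ ε₂₉ B₃ B₃' a₀ a₁).res.X P).withB8OfRecordSubBP (theta13OfThm1CCMW F N j γ ε₀ ε₂₉ B₃ B₃' a₀ a₁).toStage3Params lam8).withB12 (F12OfRecord₁₂ F N (theta13OfThm1CCMW F N j γ ε₀ ε₂₉ B₃ B₃' a₀ a₁).toStage12Params lam12 P) (lam12 P).consts).withB13OfRecord (theta13OfThm1CCMW F N j γ ε₀ ε₂₉ B₃ B₃' a₀ a₁).toStage3Params (lam13 P)))).view₁₃CoPHB10YZW F N Mstar ops ζ lamW) }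
  have hC : w.C = (datumOfRecord₁₃SepCoPH F N (Stage13HParams.ofHistoryBlind F N ⟨theta13OfThm1CCMW F N j γ ε₀ ε₂₉ B₃ B₃' a₀ a₁, ZrOfRecord₁₃ F N (theta13OfThm1CCMW F N j γ ε₀ ε₂₉ B₃ B₃' a₀ a₁)⟩) (N24_provisos₁₃SepCoPH_door_theta13OfThm1CCMW_of_gauge9TopStepR_of_betaBoxSignFree_allTorus hγ₀ hγh hε hε' hB hB' ha₀ ha₁ h15 hc h9 hbox hbox' hl hβ')).C := rfl
  have hθ := admissible_theta13OfThm1CCMW_of_le_half F N hγ₀ hγh hε hε' hB hB' ha₀ ha₁ (j := j) (ε₀ := ε₀) (ε₂₉ := ε₂₉)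
  have hU : (Stage13HParams.ofHistoryBlind F N ⟨theta13OfThm1CCMW F N j γ ε₀ ε₂₉ B₃ B₃' a₀ a₁, ZrOfRecord₁₃ F N (theta13OfThm1CCMW F N j γ ε₀ ε₂₉ B₃ B₃' a₀ a₁)⟩).ZhUnity F N ∧ (Stage13HParams.ofHistoryBlind F N ⟨theta13OfThm1CCMW F N j γ ε₀ ε₂₉ B₃ B₃' a₀ a₁, ZrOfRecord₁₃ F N (theta13OfThm1CCMW F N j γ ε₀ ε₂₉ B₃ B₃' a₀ a₁)⟩).SlotsNondegenerate₁₃ F N :=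
    ⟨(Stage13RParams.ZrUnity.ofHistoryBlind (θ := ⟨theta13OfThm1CCMW F N j γ ε₀ ε₂₉ B₃ B₃' a₀ a₁, ZrOfRecord₁₃ F N (theta13OfThm1CCMW F N j γ ε₀ ε₂₉ B₃ B₃' a₀ a₁)⟩)
      fun p i ω => finsum_ζ0_ZrOfRecord₁₃ (θ := theta13OfThm1CCMW F N j γ ε₀ ε₂₉ B₃ B₃' a₀ a₁) (p := p) i ω),
     slotsNondegenerate₁₃_theta13OfThm1CCMW F N j γ ε₀ ε₂₉ B₃ B₃' a₀ a₁⟩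
  have hlaws : ∀ (P : B12.RunParams) (k : ℕ), k < P.K → TLaw₁₃CoPH F N (Stage13HParams.ofHistoryBlind F N ⟨theta13OfThm1CCMW F N j γ ε₀ ε₂₉ B₃ B₃' a₀ a₁, ZrOfRecord₁₃ F N (theta13OfThm1CCMW F N j γ ε₀ ε₂₉ B₃ B₃' a₀ a₁)⟩) P k → SLaw₁₃CoPH F N (Stage13HParams.ofHistoryBlind F N ⟨theta13OfThm1CCMW F N j γ ε₀ ε₂₉ B₃ B₃' a₀ a₁, ZrOfRecord₁₃ F N (theta13OfThm1CCMW F N j γ ε₀ ε₂₉ B₃ B₃' a₀ a₁)⟩) P (k + 1) := fun P =>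
    N24_laws₁₃CoPH_theta13OfThm1CCMW (ZrOfRecord₁₃ F N (theta13OfThm1CCMW F N j γ ε₀ ε₂₉ B₃ B₃' a₀ a₁)) (fun p _ _ _ => ZrOfRecord₁₃ F N (theta13OfThm1CCMW F N j γ ε₀ ε₂₉ B₃ B₃' a₀ a₁) p) (fun p _ _ _ => ((theta13OfThm1CCMW F N j γ ε₀ ε₂₉ B₃ B₃' a₀ a₁).Rz p.K).phi) P hγ₀ hγh hε hε' hB hB' ha₀ ha₁
  have hUVw : ∀ P : B12.RunParams, (genFlow (betaOfRecord₁₃ F N (Stage13HParams.ofHistoryBlind F N ⟨theta13OfThm1CCMW F N j γ ε₀ ε₂₉ B₃ B₃' a₀ a₁, ZrOfRecord₁₃ F N (theta13OfThm1CCMW F N j γ ε₀ ε₂₉ B₃ B₃' a₀ a₁)⟩).toStage13Params) P.g0).InInterval w.γ P.K → ∀ k, k ≤ P.K → SLaw₁₃CoPH F N (Stage13HParams.ofHistoryBlind F N ⟨theta13OfThm1CCMW F N j γ ε₀ ε₂₉ B₃ B₃' a₀ a₁, ZrOfRecord₁₃ F N (theta13OfThm1CCMW F N j γ ε₀ ε₂₉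 B₃ B₃' a₀ a₁)⟩) P k →
      ∀ U : GaugeField (F.P P.K) k (SU N),
        chiβOfRecord₁₃ F N (Stage13HParams.ofHistoryBlind F N ⟨theta13OfThm1CCMW F N j γ ε₀ ε₂₉ B₃ B₃' a₀ a₁, ZrOfRecord₁₃ F N (theta13OfThm1CCMW F N j γ ε₀ ε₂₉ B₃ B₃' a₀ a₁)⟩).toStage13Params P.K (gOfRecord₁₃ F N (Stage13HParams.ofHistoryBlind F N ⟨theta13OfThm1CCMW F N j γ ε₀ ε₂₉ B₃ B₃' a₀ a₁, ZrOfRecord₁₃ F N (theta13OfThm1CCMW F N j γ ε₀ ε₂₉ B₃ B₃' a₀ a₁)⟩).toStage13Params P) k U *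
              Real.exp (-(1 / (gOfRecord₁₃ F N (Stage13HParams.ofHistoryBlind F N ⟨theta13OfThm1CCMW F N j γ ε₀ ε₂₉ B₃ B₃' a₀ a₁, ZrOfRecord₁₃ F N (theta13OfThm1CCMW F N j γ ε₀ ε₂₉ B₃ B₃' a₀ a₁)⟩).toStage13Params P k) ^ 2 * wilsonBGOfRecord F N (Stage13HParams.ofHistoryBlind F N ⟨theta13OfThm1CCMW F N j γ ε₀ ε₂₉ B₃ B₃' a₀ a₁, ZrOfRecord₁₃ F N (theta13OfThm1CCMW F N j γ ε₀ ε₂₉ B₃ B₃' a₀ a₁)⟩).εbg P k U)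
                - w.em (gOfRecord₁₃ F N (Stage13HParams.ofHistoryBlind F N ⟨theta13OfThm1CCMW F N j γ ε₀ ε₂₉ B₃ B₃' a₀ a₁, ZrOfRecord₁₃ F N (theta13OfThm1CCMW F N j γ ε₀ ε₂₉ B₃ B₃' a₀ a₁)⟩).toStage13Params P k) * (Fintype.card (Site (F.P P.K) k) : ℝ)) ≤ densOfRecord₁₃ F N (Stage13HParams.ofHistoryBlind F N ⟨theta13OfThm1CCMW F N j γ ε₀ ε₂₉ B₃ B₃' a₀ a₁, ZrOfRecord₁₃ F N (theta13OfThm1CCMW F N j γ ε₀ ε₂₉ B₃ B₃' a₀ a₁)⟩).toStage13Params P k U ∧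
        densOfRecord₁₃ F N (Stage13HParams.ofHistoryBlind F N ⟨theta13OfThm1CCMW F N j γ ε₀ ε₂₉ B₃ B₃' a₀ a₁, ZrOfRecord₁₃ F N (theta13OfThm1CCMW F N j γ ε₀ ε₂₉ B₃ B₃' a₀ a₁)⟩).toStage13Params P k U ≤ Real.exp (w.ep (gOfRecord₁₃ F N (Stage13HParams.ofHistoryBlind F N ⟨theta13OfThm1CCMW F N j γ ε₀ ε₂₉ B₃ B₃' a₀ a₁, ZrOfRecord₁₃ F N (theta13OfThm1CCMW F N j γ ε₀ ε₂₉ B₃ B₃' a₀ a₁)⟩).toStage13Params P k) * (Fintype.card (Site (F.P P.K) k) : ℝ)) :=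
    fun P hI k hk hS U => hUV P (B14Cor3.inInterval_of_le hI hγw13) k hk hS U
  exact N24_nodesAtSomeRecordS₁₃SepCoPH_of_rebindXS_fourPin_pointed (Stage13HParams.ofHistoryBlind F N ⟨theta13OfThm1CCMW F N j γ ε₀ ε₂₉ B₃ B₃' a₀ a₁, ZrOfRecord₁₃ F N (theta13OfThm1CCMW F N j γ ε₀ ε₂₉ B₃ B₃' a₀ a₁)⟩) (N24_provisos₁₃SepCoPH_door_theta13OfThm1CCMW_of_gauge9TopStepR_of_betaBoxSignFree_allTorus hγ₀ hγh hε hε' hB hB' ha₀ ha₁ h15 hc h9 hbox hbox' hl hβ') hθ hU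
    (fun P : B12.RunParams => (((((theta13OfThm1CCMW F N j γ ε₀ ε₂₉ B₃ B₃' a₀ a₁).res.X P).withB8OfRecordSubBP (theta13OfThm1CCMW F N j γ ε₀ ε₂₉ B₃ B₃' a₀ a₁).toStage3Params lam8).withB12 (F12OfRecord₁₂ F N (theta13OfThm1CCMW F N j γ ε₀ ε₂₉ B₃ B₃' a₀ a₁).toStage12Params lam12 P) (lam12 P).consts).withB13OfRecord (theta13OfThm1CCMW F N j γ ε₀ ε₂₉ B₃ B₃' a₀ a₁).toStage3Params (lam13 P))) Mstar ops ζ lamW w hC ⟨hγw0, hγwγ⟩ rfl (fun P => rfl)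
    (fun P => h05) h06 h07 h08 (fun P => h09 P) (h09T w hC hγw9) (fun P _ _ _ _ => h10 P) (h11 w hC rfl rfl hγw11) h12 hlaws hUVw hK

end generalN

/-! ## §3–§4. `N = 2`: K1⁷'s consequent and the registered rung-1 body at `F` from V19's three stub texts at `F` and the SPLIT children families (Part 19 with `hchildren` split, N05 on the P-slot) -/

/-- **★★★ K1⁷'s θ-KEYED CONSEQUENT AT THE FAMILY `F` FROM EXACTLY V19's THREE STUB TEXTS AT `F` AND ELEVEN WORLD-FREE CHILDREN FAMILIES, THE WORLD BUILT BY N24, N05 ON THE P-SLOT** — `h1F ∕ h2PF ∕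
h3A'F` are the bodies of V19's registered stubs `stub_prop8StepCoP13` ∕ `stub_prop6MemberB8AtP13` (2′) ∕ `stub_absBetaBoxAtThm1WitnessCCMGen13` (3ᴬ′) read at `F` (verbatim as in dag-n21-c
PART 2); the children's side is ONE FAMILY PER LANE over Part 14's door letters (cube letter `(j, c)` with `c ≤ L^j`, window `0 < γ ≤ ½`, thresholds, signs, [15] Thm 1's sentence, the
(9)-token, the sign-free windowed box with its two letters): `h05F` (P-slot) `h06F` `h07` `h08` `h09F` `h09TF` `h10F` `h11F` `h12F` `hUVF` + NODE O's `hOF` — bodies as in §1.  PROOF: Part 19's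
stub-opening verbatim (PART 2's `gauge9Supplier_of_prop6MemberP`, dag-n07-e's bridge, 3ᴬ′, `windowLetters_of_absBetaBoxH`, dag-n21-c's `…_of_half` transfers), then §1 at the families.
So «WHICH CHILD BLOCKS K1⁷» (closing form, V19, split, P-slot): V19's three print stubs + `h05F h06F h07 h08 h09F h09TF h10F h11F h12F hUVF` + NODE O's `hOF`; the K0 box's upper half and the
world are N24's and DONE here.  COMPOSITE and CONDITIONAL: every hypothesis displayed; nothing of Bałaban asserted; K0⁷ ∕ K1⁷ NOT closed; no stub closed; no count moved. [cite: Balaban1989LargeFieldII, Thm 1 p.355, (0.1) pp.355–356, p.391; Balaban1988Convergent, Thm 1 p.262, Cor. 3 (2.50) p.264, (3.16)–(3.23) pp.268–270; Balaban1987RG1, Thm 1 p.255, Thm 3 p.264, Lemma 4 p.280, (0.17)–(0.20) pp.255–256, (1.20)–(1.22) p.264; Balaban1985Variational, Thm 1 (8)–(9) p.279, Prop. 8 p.304; Balaban1985RegularSpaces, Lemma 1 p.79 – Thm 8 p.101, Prop. 6 p.99, Thm 8 (1.146) p.101; Balaban1985BackgroundPropagators, Thm 3.1 p.397; Balaban1985UV3,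 Thm 1 p.257; Balaban1988RG2Cluster, Lemmas 1–3 pp.9–20; Balaban1989LargeFieldI, Prop. 1 p.194 (bookkeeping)] -/
theorem N24_stabilityBR13SepCoPH_consequent_of_stubs1_2P_3A'_of_childrenSplit
    (h1F : ∃ B₃ a₀ a₁ : ℝ, 2 * (F.L : ℝ) ^ 2 ≤ B₃ ∧ 0 < a₀ ∧ 0 < a₁ ∧
      Prop8RegSepTopStep F 2 (fun ν K Ω => suppDomOfRecord F ν K Ω) B₃ a₀ a₁)
    (h2PF : ∃ (ρ₀ : ℕ) (B₁ c₁ : ℝ), 1 ≤ ρ₀ ∧ 0 ≤ B₁ ∧ 0 < c₁ ∧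
      (letI : CStarAlgebra (MatA 2) := {}; B8.Prop6Printed 4 (F.L : ℝ) B₁ c₁ (fun i : B8LeafModelZd.ZdIdx 4 F.L => zdCubP (MatA 2) F.L ρ₀ i)))
    (h3A'F : ∀ (j c : ℕ) (B₃ B₃' a₀ a₁ : ℝ), c ≤ F.L ^ j → 2 * (F.L : ℝ) ^ 2 ≤ B₃ → 0 < B₃' → 0 < a₀ → 0 < a₁ →
      VariationalThm1RegSepCoP7M F 2 B₃ a₀ a₁ →
      Gauge9RegSepTopStepR F 2 (fun ν K Ω => suppDomOfRecord F ν K Ω) (F.L ^ j) c B₃ B₃' a₀ a₁ →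
      ∃ γ₀ ε₀ ε₂₉ β' : ℝ, 0 < γ₀ ∧ 0 < ε₀ ∧ 0 < ε₂₉ ∧
        BetaLowerH (-β') γ₀ (betaOfRecord₁₃ F 2 (theta13OfThm1CCM F 2 j ε₀ ε₂₉ B₃ B₃' a₀ a₁)) ∧
        BetaUpperH β' γ₀ (betaOfRecord₁₃ F 2 (theta13OfThm1CCM F 2 j ε₀ ε₂₉ B₃ B₃' a₀ a₁)))
    (h05F : ∀ {j c : ℕ} {γ ε₀ ε₂₉ B₃ B₃' a₀ a₁ : ℝ} (hγ₀ : 0 < γ) (hγh : γ ≤ 1 / 2) (hε : 0 < ε₀) (hε' : 0 < ε₂₉) (hB : 0 ≤ B₃) (hB' : 0 ≤ B₃') (ha₀ : 0 < a₀) (ha₁ : 0 < a₁) (h15 : VariationalThm1RegSepCoP7M F 2 B₃ a₀ a₁) (hc : c ≤ F.L ^ j) (h9 : Gauge9RegSepTopStepR F 2 (fun ν K Ω => suppDomOfRecord F ν K Ω) (F.L ^ j) c B₃ B₃' a₀ a₁) {bl β' : ℝ} (hbox : BetaLowerH bl γ (betaOfRecord₁₃ F 2 (theta13OfThm1CCMW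 F 2 j γ ε₀ ε₂₉ B₃ B₃' a₀ a₁))) (hbox' : BetaUpperH β' γ (betaOfRecord₁₃ F 2 (theta13OfThm1CCMW F 2 j γ ε₀ ε₂₉ B₃ B₃' a₀ a₁))) (hl : -bl * γ ^ 2 ≤ 3) (hβ' : β' * γ ^ 2 ≤ 3 / 4),
      ∃ lam8 : ResidB8 (theta13OfThm1CCMW F 2 j γ ε₀ ε₂₉ B₃ B₃' a₀ a₁).toStage3Params, B8LeafOfRecordSubBP (theta13OfThm1CCMW F 2 j γ ε₀ ε₂₉ B₃ B₃' a₀ a₁).toStage3Params lam8)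
    (h06F : ∀ {j c : ℕ} {γ ε₀ ε₂₉ B₃ B₃' a₀ a₁ : ℝ} (hγ₀ : 0 < γ) (hγh : γ ≤ 1 / 2) (hε : 0 < ε₀) (hε' : 0 < ε₂₉) (hB : 0 ≤ B₃) (hB' : 0 ≤ B₃') (ha₀ : 0 < a₀) (ha₁ : 0 < a₁) (h15 : VariationalThm1RegSepCoP7M F 2 B₃ a₀ a₁) (hc : c ≤ F.L ^ j) (h9 : Gauge9RegSepTopStepR F 2 (fun ν K Ω => suppDomOfRecord F ν K Ω) (F.L ^ j) c B₃ B₃' a₀ a₁) {bl β' : ℝ} (hbox : BetaLowerH bl γ (betaOfRecord₁₃ F 2 (theta13OfThm1CCMW F 2 j γ ε₀ ε₂₉ B₃ B₃' a₀ a₁))) (hbox' : BetaUpperH β' γ (betaOfRecord₁₃ F 2 (theta13OfThm1CCMW F 2 j γ ε₀ ε₂₉ B₃ B₃' a₀ a₁))) (hl : -bl * γ ^ 2 ≤ 3) (hβ' : β' * γ ^ 2 ≤ 3 / 4),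
      ∃ (Mstar : ℕ) (ops : OpsY 2 (theta13OfThm1CCMW F 2 j γ ε₀ ε₂₉ B₃ B₃' a₀ a₁).toStage3Params Mstar), B9LeafX (Y9OfRecord 2 (theta13OfThm1CCMW F 2 j γ ε₀ ε₂₉ B₃ B₃' a₀ a₁).toStage3Params Mstar ops))
    (h07 : ∃ ζ : ResidZ F 2, B11Leaf (Z11OfRecord F 2 ζ))
    (h08 : PrintedUV3V 2 F.L)
    (h09F : ∀ {j c : ℕ} {γ ε₀ ε₂₉ B₃ B₃' a₀ a₁ : ℝ} (hγ₀ : 0 < γ) (hγh : γ ≤ 1 / 2) (hε : 0 < ε₀) (hε' : 0 < ε₂₉) (hB : 0 ≤ B₃) (hB' : 0 ≤ B₃') (ha₀ : 0 < a₀) (ha₁ : 0 < a₁) (h15 : VariationalThm1RegSepCoP7M F 2 B₃ a₀ a₁) (hc : c ≤ F.L ^ j) (h9 : Gauge9RegSepTopStepR F 2 (fun ν K Ω => suppDomOfRecord F ν K Ω) (F.L ^ j) c B₃ B₃' a₀ a₁) {bl β' : ℝ} (hbox : BetaLowerH bl γ (betaOfRecord₁₃ F 2 (theta13OfThm1CCMW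 F 2 j γ ε₀ ε₂₉ B₃ B₃' a₀ a₁))) (hbox' : BetaUpperH β' γ (betaOfRecord₁₃ F 2 (theta13OfThm1CCMW F 2 j γ ε₀ ε₂₉ B₃ B₃' a₀ a₁))) (hl : -bl * γ ^ 2 ≤ 3) (hβ' : β' * γ ^ 2 ≤ 3 / 4),
      ∃ lam12 : ResidB12 F 2 (theta13OfThm1CCMW F 2 j γ ε₀ ε₂₉ B₃ B₃' a₀ a₁).τ9.M,
      ∀ P : B12.RunParams, B12Sec2to5.Lemma4Printed (F12OfRecord₁₂ F 2 (theta13OfThm1CCMW F 2 j γ ε₀ ε₂₉ B₃ B₃' a₀ a₁).toStage12Params lam12 P) (lam12 P).consts)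
    (h09TF : ∀ {j c : ℕ} {γ ε₀ ε₂₉ B₃ B₃' a₀ a₁ : ℝ} (hγ₀ : 0 < γ) (hγh : γ ≤ 1 / 2) (hε : 0 < ε₀) (hε' : 0 < ε₂₉) (hB : 0 ≤ B₃) (hB' : 0 ≤ B₃') (ha₀ : 0 < a₀) (ha₁ : 0 < a₁) (h15 : VariationalThm1RegSepCoP7M F 2 B₃ a₀ a₁) (hc : c ≤ F.L ^ j) (h9 : Gauge9RegSepTopStepR F 2 (fun ν K Ω => suppDomOfRecord F ν K Ω) (F.L ^ j) c B₃ B₃' a₀ a₁) {bl β' : ℝ} (hbox : BetaLowerH bl γ (betaOfRecord₁₃ F 2 (theta13OfThm1CCMW F 2 j γ ε₀ ε₂₉ B₃ B₃' a₀ a₁))) (hbox' : BetaUpperH β' γ (betaOfRecord₁₃ F 2 (theta13OfThm1CCMW F 2 j γ ε₀ ε₂₉ B₃ B₃' a₀ a₁))) (hl : -bl * γ ^ 2 ≤ 3) (hβ' : β' * γ ^ 2 ≤ 3 / 4),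
      ∃ γ₉ : ℝ, 0 < γ₉ ∧ ∀ w : WorldP, w.C = (datumOfRecord₁₃SepCoPH F 2 (Stage13HParams.ofHistoryBlind F 2 ⟨theta13OfThm1CCMW F 2 j γ ε₀ ε₂₉ B₃ B₃' a₀ a₁, ZrOfRecord₁₃ F 2 (theta13OfThm1CCMW F 2 j γ ε₀ ε₂₉ B₃ B₃' a₀ a₁)⟩) (N24_provisos₁₃SepCoPH_door_theta13OfThm1CCMW_of_gauge9TopStepR_of_betaBoxSignFree_allTorus hγ₀ hγh hε hε' hB hB' ha₀ ha₁ h15 hc h9 hbox hbox' hl hβ')).C →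
      w.γ ≤ γ₉ → ∀ P : B12.RunParams, (leavesP w P).smallCouplings → (leavesP w P).smallFieldInductive)
    (h10F : ∀ {j c : ℕ} {γ ε₀ ε₂₉ B₃ B₃' a₀ a₁ : ℝ} (hγ₀ : 0 < γ) (hγh : γ ≤ 1 / 2) (hε : 0 < ε₀) (hε' : 0 < ε₂₉) (hB : 0 ≤ B₃) (hB' : 0 ≤ B₃') (ha₀ : 0 < a₀) (ha₁ : 0 < a₁) (h15 : VariationalThm1RegSepCoP7M F 2 B₃ a₀ a₁) (hc : c ≤ F.L ^ j) (h9 : Gauge9RegSepTopStepR F 2 (fun ν K Ω => suppDomOfRecord F ν K Ω) (F.L ^ j) c B₃ B₃' a₀ a₁) {bl β' : ℝ} (hbox : BetaLowerH bl γ (betaOfRecord₁₃ F 2 (theta13OfThm1CCMW F 2 j γ ε₀ ε₂₉ B₃ B₃' a₀ a₁))) (hbox' : BetaUpperH β' γ (betaOfRecord₁₃ F 2 (theta13OfThm1CCMW F 2 j γ ε₀ ε₂₉ B₃ B₃' a₀ a₁))) (hl : -bl * γ ^ 2 ≤ 3) (hβ' : β' * γ ^ 2 ≤ 3 / 4),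
      ∃ lam13 : B12.RunParams → ResidB13 (theta13OfThm1CCMW F 2 j γ ε₀ ε₂₉ B₃ B₃' a₀ a₁).toStage3Params,
      ∀ P : B12.RunParams, B13LeafOfRecord (theta13OfThm1CCMW F 2 j γ ε₀ ε₂₉ B₃ B₃' a₀ a₁).toStage3Params (lam13 P))
    (h11F : ∀ {j c : ℕ} {γ ε₀ ε₂₉ B₃ B₃' a₀ a₁ : ℝ} (hγ₀ : 0 < γ) (hγh : γ ≤ 1 / 2) (hε : 0 < ε₀) (hε' : 0 < ε₂₉) (hB : 0 ≤ B₃) (hB' : 0 ≤ B₃') (ha₀ : 0 < a₀) (ha₁ : 0 < a₁) (h15 : VariationalThm1RegSepCoP7M F 2 B₃ a₀ a₁) (hc : c ≤ F.L ^ j) (h9 : Gauge9RegSepTopStepR F 2 (fun ν K Ω => suppDomOfRecord F ν K Ω) (F.L ^ j) c B₃ B₃' a₀ a₁) {bl β' : ℝ} (hbox : BetaLowerH bl γ (betaOfRecord₁₃ F 2 (theta13OfThm1CCMW F 2 j γ ε₀ ε₂₉ B₃ B₃' a₀ a₁))) (hbox' : BetaUpperH β' γ (betaOfRecord₁₃ F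 2 (theta13OfThm1CCMW F 2 j γ ε₀ ε₂₉ B₃ B₃' a₀ a₁))) (hl : -bl * γ ^ 2 ≤ 3) (hβ' : β' * γ ^ 2 ≤ 3 / 4),
      ∀ βup β₀ : ℝ, ∃ γ₁₁ : ℝ, 0 < γ₁₁ ∧ ∀ w : WorldP, w.C = (datumOfRecord₁₃SepCoPH F 2 (Stage13HParams.ofHistoryBlind F 2 ⟨theta13OfThm1CCMW F 2 j γ ε₀ ε₂₉ B₃ B₃' a₀ a₁, ZrOfRecord₁₃ F 2 (theta13OfThm1CCMW F 2 j γ ε₀ ε₂₉ B₃ B₃' a₀ a₁)⟩) (N24_provisos₁₃SepCoPH_door_theta13OfThm1CCMW_of_gauge9TopStepR_of_betaBoxSignFree_allTorus hγ₀ hγh hε hε' hB hB' ha₀ ha₁ h15 hc h9 hbox hbox' hl hβ')).C →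
      w.βup = βup → w.β₀ = β₀ → w.γ ≤ γ₁₁ → ∀ P : B12.RunParams, (leavesP w P).b7 → (leavesP w P).b8 → (leavesP w P).b9 → (leavesP w P).b10 → (leavesP w P).b11 →
      (leavesP w P).smallCouplings → (leavesP w P).smallFieldInductive → (leavesP w P).flowControl →
        ∀ k, k < P.K → SLaw₁₃CoPH F 2 (Stage13HParams.ofHistoryBlind F 2 ⟨theta13OfThm1CCMW F 2 j γ ε₀ ε₂₉ B₃ B₃' a₀ a₁, ZrOfRecord₁₃ F 2 (theta13OfThm1CCMW F 2 j γ ε₀ ε₂₉ B₃ B₃' a₀ a₁)⟩) P k → TLaw₁₃CoPH F 2 (Stage13HParams.ofHistoryBlind F 2 ⟨theta13OfThm1CCMW F 2 j γ ε₀ ε₂₉ B₃ B₃' a₀ a₁, ZrOfRecord₁₃ F 2 (theta13OfThm1CCMW F 2 j γ ε₀ ε₂₉ B₃ B₃' a₀ a₁)⟩) P k)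
    (h12F : ∀ {j c : ℕ} {γ ε₀ ε₂₉ B₃ B₃' a₀ a₁ : ℝ} (hγ₀ : 0 < γ) (hγh : γ ≤ 1 / 2) (hε : 0 < ε₀) (hε' : 0 < ε₂₉) (hB : 0 ≤ B₃) (hB' : 0 ≤ B₃') (ha₀ : 0 < a₀) (ha₁ : 0 < a₁) (h15 : VariationalThm1RegSepCoP7M F 2 B₃ a₀ a₁) (hc : c ≤ F.L ^ j) (h9 : Gauge9RegSepTopStepR F 2 (fun ν K Ω => suppDomOfRecord F ν K Ω) (F.L ^ j) c B₃ B₃' a₀ a₁) {bl β' : ℝ} (hbox : BetaLowerH bl γ (betaOfRecord₁₃ F 2 (theta13OfThm1CCMW F 2 j γ ε₀ ε₂₉ B₃ B₃' a₀ a₁))) (hbox' : BetaUpperH β' γ (betaOfRecord₁₃ F 2 (theta13OfThm1CCMW F 2 j γ ε₀ ε₂₉ B₃ B₃' a₀ a₁))) (hl : -bl * γ ^ 2 ≤ 3) (hβ' : β' * γ ^ 2 ≤ 3 / 4),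
      ∃ lamW : ResidW F 2, (∀ P : B12.RunParams, B15Leaf (WOfRecord₁₃ F 2 (theta13OfThm1CCMW F 2 j γ ε₀ ε₂₉ B₃ B₃' a₀ a₁) lamW P)) ∧
      ∀ P : B12.RunParams, 1 ≤ P.K → lamW.kSel P < P.K)
    (hUVF : ∀ {j c : ℕ} {γ ε₀ ε₂₉ B₃ B₃' a₀ a₁ : ℝ} (hγ₀ : 0 < γ) (hγh : γ ≤ 1 / 2) (hε : 0 < ε₀) (hε' : 0 < ε₂₉) (hB : 0 ≤ B₃) (hB' : 0 ≤ B₃') (ha₀ : 0 < a₀) (ha₁ : 0 < a₁) (h15 : VariationalThm1RegSepCoP7M F 2 B₃ a₀ a₁) (hc : c ≤ F.L ^ j) (h9 : Gauge9RegSepTopStepR F 2 (fun ν K Ω => suppDomOfRecord F ν K Ω) (F.L ^ j) c B₃ B₃' a₀ a₁) {bl β' : ℝ} (hbox : BetaLowerH bl γ (betaOfRecord₁₃ F 2 (theta13OfThm1CCMW F 2 j γ ε₀ ε₂₉ B₃ B₃' a₀ a₁))) (hbox' : BetaUpperH β' γ (betaOfRecord₁₃ F 2 (theta13OfThm1CCMW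 F 2 j γ ε₀ ε₂₉ B₃ B₃' a₀ a₁))) (hl : -bl * γ ^ 2 ≤ 3) (hβ' : β' * γ ^ 2 ≤ 3 / 4),
      ∃ γ₁₃ : ℝ, 0 < γ₁₃ ∧ ∃ em ep : ℝ → ℝ, ∀ P : B12.RunParams, (genFlow (betaOfRecord₁₃ F 2 (theta13OfThm1CCMW F 2 j γ ε₀ ε₂₉ B₃ B₃' a₀ a₁)) P.g0).InInterval γ₁₃ P.K → ∀ k, k ≤ P.K → SLaw₁₃CoPH F 2 (Stage13HParams.ofHistoryBlind F 2 ⟨theta13OfThm1CCMW F 2 j γ ε₀ ε₂₉ B₃ B₃' a₀ a₁, ZrOfRecord₁₃ F 2 (theta13OfThm1CCMW F 2 j γ ε₀ ε₂₉ B₃ B₃' a₀ a₁)⟩) P k →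
      ∀ U : GaugeField (F.P P.K) k (SU 2),
        chiβOfRecord₁₃ F 2 (theta13OfThm1CCMW F 2 j γ ε₀ ε₂₉ B₃ B₃' a₀ a₁) P.K (gOfRecord₁₃ F 2 (theta13OfThm1CCMW F 2 j γ ε₀ ε₂₉ B₃ B₃' a₀ a₁) P) k U *
              Real.exp (-(1 / (gOfRecord₁₃ F 2 (theta13OfThm1CCMW F 2 j γ ε₀ ε₂₉ B₃ B₃' a₀ a₁) P k) ^ 2 * wilsonBGOfRecord F 2 (theta13OfThm1CCMW F 2 j γ ε₀ ε₂₉ B₃ B₃' a₀ a₁).εbg P k U)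
                - em (gOfRecord₁₃ F 2 (theta13OfThm1CCMW F 2 j γ ε₀ ε₂₉ B₃ B₃' a₀ a₁) P k) * (Fintype.card (Site (F.P P.K) k) : ℝ)) ≤ densOfRecord₁₃ F 2 (theta13OfThm1CCMW F 2 j γ ε₀ ε₂₉ B₃ B₃' a₀ a₁) P k U ∧
        densOfRecord₁₃ F 2 (theta13OfThm1CCMW F 2 j γ ε₀ ε₂₉ B₃ B₃' a₀ a₁) P k U ≤ Real.exp (ep (gOfRecord₁₃ F 2 (theta13OfThm1CCMW F 2 j γ ε₀ ε₂₉ B₃ B₃' a₀ a₁) P k) * (Fintype.card (Site (F.P P.K) k) : ℝ)))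
    (hOF : ∀ {j c : ℕ} {γ ε₀ ε₂₉ B₃ B₃' a₀ a₁ : ℝ} (hγ₀ : 0 < γ) (hγh : γ ≤ 1 / 2) (hε : 0 < ε₀) (hε' : 0 < ε₂₉) (hB : 0 ≤ B₃) (hB' : 0 ≤ B₃') (ha₀ : 0 < a₀) (ha₁ : 0 < a₁) (h15 : VariationalThm1RegSepCoP7M F 2 B₃ a₀ a₁) (hc : c ≤ F.L ^ j) (h9 : Gauge9RegSepTopStepR F 2 (fun ν K Ω => suppDomOfRecord F ν K Ω) (F.L ^ j) c B₃ B₃' a₀ a₁) {bl β' : ℝ} (hbox : BetaLowerH bl γ (betaOfRecord₁₃ F 2 (theta13OfThm1CCMW F 2 j γ ε₀ ε₂₉ B₃ B₃' a₀ a₁))) (hbox' : BetaUpperH β' γ (betaOfRecord₁₃ F 2 (theta13OfThm1CCMW F 2 j γ ε₀ ε₂₉ B₃ B₃' a₀ a₁))) (hl : -bl * γ ^ 2 ≤ 3) (hβ' : β' * γ ^ 2 ≤ 3 / 4),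
      ∃ b : ℝ, 0 < b ∧ ∃ γO : ℝ, 0 < γO ∧ BetaLowerH b γO (betaOfRecord₁₃ F 2 (theta13OfThm1CCMW F 2 j γ ε₀ ε₂₉ B₃ B₃' a₀ a₁))) :
    ∃ (θ' : Stage13HParams F 2) (h' : θ'.Provisos₁₃SepCoPH F 2), (θ'.ZhUnity F 2 ∧ θ'.SlotsNondegenerate₁₃ F 2) ∧ θ'.Admissible F 2 ∧
      B16.EndStatementBPrinted (datumOfRecord₁₃SepCoPH F 2 θ' h').C ∧
      ∃ γ₁ : ℝ, 0 < γ₁ ∧ ∀ γ : ℝ, 0 < γ → γ ≤ γ₁ → ∃ P : B12.RunParams, 1 ≤ P.K ∧ ((datumOfRecord₁₃SepCoPH F 2 θ' h').C P).flow.InInterval γ P.K := by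
  obtain ⟨B₃, a₀, a₁, hB₃, ha₀, ha₁, h8⟩ := h1F
  have hL0 : (0 : ℝ) < (F.L : ℝ) := by exact_mod_cast lt_trans Nat.zero_lt_one F.hL.2
  have hBpos : (0 : ℝ) < B₃ := lt_of_lt_of_le (mul_pos two_pos (pow_pos hL0 2)) hB₃
  obtain ⟨j, c, B₉, a₁', hc, hB9, ha₁', ha₁'le, h9⟩ := gauge9Supplier_of_prop6MemberP F h2PF B₃ a₀ a₁ hB₃ ha₀ ha₁ h8
  have h15 : VariationalThm1RegSepCoP7M F 2 B₃ a₀ a₁' := variationalThm1RegSepCoP7M_of_prop8TopStep hBpos (h8.of_le le_rfl ha₁'le)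
  obtain ⟨γ₀, ε₀, ε₂₉, β', hγ0, hε, hε', hlow, hup⟩ := h3A'F j c B₃ B₉ a₀ a₁' hc hB₃ hB9 ha₀ ha₁' h15 h9
  obtain ⟨γ, hγpos, hγh, hl, hu, hlow', hup'⟩ := windowLetters_of_absBetaBoxH hγ0 hlow hup
  have hloW := betaLowerH_theta13OfThm1CCMW_of_half (F := F) (N := 2) (j := j) (ε₀ := ε₀) (ε₂₉ := ε₂₉) (B₃ := B₃) (B₃' := B₉) (a₀ := a₀) (a₁ := a₁') hγh hlow'
  have hupW := betaUpperH_theta13OfThm1CCMW_of_half (F := F) (N := 2) (j := j) (ε₀ := ε₀) (ε₂₉ := ε₂₉) (B₃ := B₃) (B₃' := B₉) (a₀ := a₀) (a₁ := a₁') hγh hup'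
  exact N24_stabilityBR13SepCoPH_worldBuilt_childrenSplit_theta13OfThm1CCMW_of_gauge9TopStepR_of_betaBoxSignFree_allTorus_door hγpos hγh hε hε' hBpos.le hB9.le ha₀ ha₁' h15 hc h9 hloW hupW hl hu
    (h05F hγpos hγh hε hε' hBpos.le hB9.le ha₀ ha₁' h15 hc h9 hloW hupW hl hu) (h06F hγpos hγh hε hε' hBpos.le hB9.le ha₀ ha₁' h15 hc h9 hloW hupW hl hu) h07 h08 (h09F hγpos hγh hε hε' hBpos.le hB9.le ha₀ ha₁' h15 hc h9 hloW hupW hl hu) (h09TF hγpos hγh hε hε' hBpos.le hB9.le ha₀ ha₁' h15 hc h9 hloW hupW hl hu) (h10F hγpos hγh hε hε' hBpos.le hB9.le ha₀ ha₁' h15 hc h9 hloW hupW hl hu) (h11F hγpos hγh hε hε' hBpos.le hB9.le ha₀ ha₁' h15 hc h9 hloW hupW hl hu) (h12F hγpos hγh hε hε' hBpos.le hB9.le ha₀ ha₁' h15 hc h9 hloW hupW hl hu) (hUVF hγpos hγh hε hε' hBpos.le hB9.le ha₀ ha₁' h15 hc h9 hloW hupW hl hu) (hOF hγpos hγh hε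 hε' hBpos.le hB9.le ha₀ ha₁' h15 hc h9 hloW hupW hl hu)

/-- **★★ RUNG 1's BODY (`NodesAtSomeRecord13PWS F`'s text at `N = 2` — K1⁷ v6's UNCHANGED stub 1 `stub_nodes13PWS`) AT THE FAMILY `F` FROM EXACTLY V19's THREE STUB TEXTS AT `F` AND TEN WORLD-FREE
CHILDREN FAMILIES, THE WORLD BUILT BY N24, N05 ON THE P-SLOT** — families as in §3, NO `hOF` (rung 1 carries no β-box).  PROOF: Part 19's stub-opening, then §2.
So `stub_nodes13PWS F _ :=` THIS THEOREM ∘ (V19's stubs as theorems) ∘ (one world-free theorem per child lane).  COMPOSITE and CONDITIONAL: every hypothesis displayed; nothing of Bałaban asserted; K0⁷ ∕ K1⁷ NOT closed; no stub closed; no count moved. [cite: Balaban1989LargeFieldII, Thm 1 p.355, (0.1) pp.355–356, p.391; Balaban1988Convergent, Thm 1 p.262, Cor. 3 (2.50) p.264, (3.16)–(3.23) pp.268–270; Balaban1987RG1, Thm 1 p.255, Thm 3 p.264, Lemma 4 p.280, (0.17)–(0.20) pp.255–256, (1.20)–(1.22) p.264; Balaban1985Variational, Thm 1 (8)–(9)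 p.279, Prop. 8 p.304; Balaban1985RegularSpaces, Lemma 1 p.79 – Thm 8 p.101, Prop. 6 p.99, Thm 8 (1.146) p.101; Balaban1985BackgroundPropagators, Thm 3.1 p.397; Balaban1985UV3, Thm 1 p.257; Balaban1988RG2Cluster, Lemmas 1–3 pp.9–20; Balaban1989LargeFieldI, Prop. 1 p.194 (bookkeeping)] -/
theorem N24_nodesAtSomeRecordS13PWS_of_stubs1_2P_3A'_of_childrenSplit
    (h1F : ∃ B₃ a₀ a₁ : ℝ, 2 * (F.L : ℝ) ^ 2 ≤ B₃ ∧ 0 < a₀ ∧ 0 < a₁ ∧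
      Prop8RegSepTopStep F 2 (fun ν K Ω => suppDomOfRecord F ν K Ω) B₃ a₀ a₁)
    (h2PF : ∃ (ρ₀ : ℕ) (B₁ c₁ : ℝ), 1 ≤ ρ₀ ∧ 0 ≤ B₁ ∧ 0 < c₁ ∧
      (letI : CStarAlgebra (MatA 2) := {}; B8.Prop6Printed 4 (F.L : ℝ) B₁ c₁ (fun i : B8LeafModelZd.ZdIdx 4 F.L => zdCubP (MatA 2) F.L ρ₀ i)))
    (h3A'F : ∀ (j c : ℕ) (B₃ B₃' a₀ a₁ : ℝ), c ≤ F.L ^ j → 2 * (F.L : ℝ) ^ 2 ≤ B₃ → 0 < B₃' → 0 < a₀ → 0 < a₁ →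
      VariationalThm1RegSepCoP7M F 2 B₃ a₀ a₁ →
      Gauge9RegSepTopStepR F 2 (fun ν K Ω => suppDomOfRecord F ν K Ω) (F.L ^ j) c B₃ B₃' a₀ a₁ →
      ∃ γ₀ ε₀ ε₂₉ β' : ℝ, 0 < γ₀ ∧ 0 < ε₀ ∧ 0 < ε₂₉ ∧
        BetaLowerH (-β') γ₀ (betaOfRecord₁₃ F 2 (theta13OfThm1CCM F 2 j ε₀ ε₂₉ B₃ B₃' a₀ a₁)) ∧
        BetaUpperH β' γ₀ (betaOfRecord₁₃ F 2 (theta13OfThm1CCM F 2 j ε₀ ε₂₉ B₃ B₃' a₀ a₁)))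
    (h05F : ∀ {j c : ℕ} {γ ε₀ ε₂₉ B₃ B₃' a₀ a₁ : ℝ} (hγ₀ : 0 < γ) (hγh : γ ≤ 1 / 2) (hε : 0 < ε₀) (hε' : 0 < ε₂₉) (hB : 0 ≤ B₃) (hB' : 0 ≤ B₃') (ha₀ : 0 < a₀) (ha₁ : 0 < a₁) (h15 : VariationalThm1RegSepCoP7M F 2 B₃ a₀ a₁) (hc : c ≤ F.L ^ j) (h9 : Gauge9RegSepTopStepR F 2 (fun ν K Ω => suppDomOfRecord F ν K Ω) (F.L ^ j) c B₃ B₃' a₀ a₁) {bl β' : ℝ} (hbox : BetaLowerH bl γ (betaOfRecord₁₃ F 2 (theta13OfThm1CCMW F 2 j γ ε₀ ε₂₉ B₃ B₃' a₀ a₁))) (hbox' : BetaUpperH β' γ (betaOfRecord₁₃ F 2 (theta13OfThm1CCMW F 2 j γ ε₀ ε₂₉ B₃ B₃' a₀ a₁))) (hl : -bl * γ ^ 2 ≤ 3) (hβ' : β' * γ ^ 2 ≤ 3 / 4),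
      ∃ lam8 : ResidB8 (theta13OfThm1CCMW F 2 j γ ε₀ ε₂₉ B₃ B₃' a₀ a₁).toStage3Params, B8LeafOfRecordSubBP (theta13OfThm1CCMW F 2 j γ ε₀ ε₂₉ B₃ B₃' a₀ a₁).toStage3Params lam8)
    (h06F : ∀ {j c : ℕ} {γ ε₀ ε₂₉ B₃ B₃' a₀ a₁ : ℝ} (hγ₀ : 0 < γ) (hγh : γ ≤ 1 / 2) (hε : 0 < ε₀) (hε' : 0 < ε₂₉) (hB : 0 ≤ B₃) (hB' : 0 ≤ B₃') (ha₀ : 0 < a₀) (ha₁ : 0 < a₁) (h15 : VariationalThm1RegSepCoP7M F 2 B₃ a₀ a₁) (hc : c ≤ F.L ^ j) (h9 : Gauge9RegSepTopStepR F 2 (fun ν K Ω => suppDomOfRecord F ν K Ω) (F.L ^ j) c B₃ B₃' a₀ a₁) {bl β' : ℝ} (hbox : BetaLowerH bl γ (betaOfRecord₁₃ F 2 (theta13OfThm1CCMW F 2 j γ ε₀ ε₂₉ B₃ B₃' a₀ a₁))) (hbox' : BetaUpperH β' γ (betaOfRecord₁₃ F 2 (theta13OfThm1CCMW F 2 j γ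 ε₀ ε₂₉ B₃ B₃' a₀ a₁))) (hl : -bl * γ ^ 2 ≤ 3) (hβ' : β' * γ ^ 2 ≤ 3 / 4),
      ∃ (Mstar : ℕ) (ops : OpsY 2 (theta13OfThm1CCMW F 2 j γ ε₀ ε₂₉ B₃ B₃' a₀ a₁).toStage3Params Mstar), B9LeafX (Y9OfRecord 2 (theta13OfThm1CCMW F 2 j γ ε₀ ε₂₉ B₃ B₃' a₀ a₁).toStage3Params Mstar ops))
    (h07 : ∃ ζ : ResidZ F 2, B11Leaf (Z11OfRecord F 2 ζ))
    (h08 : PrintedUV3V 2 F.L)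
    (h09F : ∀ {j c : ℕ} {γ ε₀ ε₂₉ B₃ B₃' a₀ a₁ : ℝ} (hγ₀ : 0 < γ) (hγh : γ ≤ 1 / 2) (hε : 0 < ε₀) (hε' : 0 < ε₂₉) (hB : 0 ≤ B₃) (hB' : 0 ≤ B₃') (ha₀ : 0 < a₀) (ha₁ : 0 < a₁) (h15 : VariationalThm1RegSepCoP7M F 2 B₃ a₀ a₁) (hc : c ≤ F.L ^ j) (h9 : Gauge9RegSepTopStepR F 2 (fun ν K Ω => suppDomOfRecord F ν K Ω) (F.L ^ j) c B₃ B₃' a₀ a₁) {bl β' : ℝ} (hbox : BetaLowerH bl γ (betaOfRecord₁₃ F 2 (theta13OfThm1CCMW F 2 j γ ε₀ ε₂₉ B₃ B₃' a₀ a₁))) (hbox' : BetaUpperH β' γ (betaOfRecord₁₃ F 2 (theta13OfThm1CCMW F 2 j γ ε₀ ε₂₉ B₃ B₃' a₀ a₁))) (hl : -bl * γ ^ 2 ≤ 3) (hβ' : β' * γ ^ 2 ≤ 3 / 4),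
      ∃ lam12 : ResidB12 F 2 (theta13OfThm1CCMW F 2 j γ ε₀ ε₂₉ B₃ B₃' a₀ a₁).τ9.M,
      ∀ P : B12.RunParams, B12Sec2to5.Lemma4Printed (F12OfRecord₁₂ F 2 (theta13OfThm1CCMW F 2 j γ ε₀ ε₂₉ B₃ B₃' a₀ a₁).toStage12Params lam12 P) (lam12 P).consts)
    (h09TF : ∀ {j c : ℕ} {γ ε₀ ε₂₉ B₃ B₃' a₀ a₁ : ℝ} (hγ₀ : 0 < γ) (hγh : γ ≤ 1 / 2) (hε : 0 < ε₀) (hε' : 0 < ε₂₉) (hB : 0 ≤ B₃) (hB' : 0 ≤ B₃') (ha₀ : 0 < a₀) (ha₁ : 0 < a₁) (h15 : VariationalThm1RegSepCoP7M F 2 B₃ a₀ a₁) (hc : c ≤ F.L ^ j) (h9 : Gauge9RegSepTopStepR F 2 (fun ν K Ω => suppDomOfRecord F ν K Ω) (F.L ^ j) c B₃ B₃' a₀ a₁) {bl β' : ℝ} (hbox : BetaLowerH bl γ (betaOfRecord₁₃ F 2 (theta13OfThm1CCMW F 2 j γ ε₀ ε₂₉ B₃ B₃' a₀ a₁))) (hbox'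 : BetaUpperH β' γ (betaOfRecord₁₃ F 2 (theta13OfThm1CCMW F 2 j γ ε₀ ε₂₉ B₃ B₃' a₀ a₁))) (hl : -bl * γ ^ 2 ≤ 3) (hβ' : β' * γ ^ 2 ≤ 3 / 4),
      ∃ γ₉ : ℝ, 0 < γ₉ ∧ ∀ w : WorldP, w.C = (datumOfRecord₁₃SepCoPH F 2 (Stage13HParams.ofHistoryBlind F 2 ⟨theta13OfThm1CCMW F 2 j γ ε₀ ε₂₉ B₃ B₃' a₀ a₁, ZrOfRecord₁₃ F 2 (theta13OfThm1CCMW F 2 j γ ε₀ ε₂₉ B₃ B₃' a₀ a₁)⟩) (N24_provisos₁₃SepCoPH_door_theta13OfThm1CCMW_of_gauge9TopStepR_of_betaBoxSignFree_allTorus hγ₀ hγh hε hε' hB hB' ha₀ ha₁ h15 hc h9 hbox hbox' hl hβ')).C →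
      w.γ ≤ γ₉ → ∀ P : B12.RunParams, (leavesP w P).smallCouplings → (leavesP w P).smallFieldInductive)
    (h10F : ∀ {j c : ℕ} {γ ε₀ ε₂₉ B₃ B₃' a₀ a₁ : ℝ} (hγ₀ : 0 < γ) (hγh : γ ≤ 1 / 2) (hε : 0 < ε₀) (hε' : 0 < ε₂₉) (hB : 0 ≤ B₃) (hB' : 0 ≤ B₃') (ha₀ : 0 < a₀) (ha₁ : 0 < a₁) (h15 : VariationalThm1RegSepCoP7M F 2 B₃ a₀ a₁) (hc : c ≤ F.L ^ j) (h9 : Gauge9RegSepTopStepR F 2 (fun ν K Ω => suppDomOfRecord F ν K Ω) (F.L ^ j) c B₃ B₃' a₀ a₁) {bl β' : ℝ} (hbox : BetaLowerH bl γ (betaOfRecord₁₃ F 2 (theta13OfThm1CCMW F 2 j γ ε₀ ε₂₉ B₃ B₃' a₀ a₁))) (hbox' : BetaUpperH β' γ (betaOfRecord₁₃ F 2 (theta13OfThm1CCMW F 2 j γ ε₀ ε₂₉ B₃ B₃' a₀ a₁))) (hl : -bl * γ ^ 2 ≤ 3) (hβ' : β' * γ ^ 2 ≤ 3 / 4),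
      ∃ lam13 : B12.RunParams → ResidB13 (theta13OfThm1CCMW F 2 j γ ε₀ ε₂₉ B₃ B₃' a₀ a₁).toStage3Params,
      ∀ P : B12.RunParams, B13LeafOfRecord (theta13OfThm1CCMW F 2 j γ ε₀ ε₂₉ B₃ B₃' a₀ a₁).toStage3Params (lam13 P))
    (h11F : ∀ {j c : ℕ} {γ ε₀ ε₂₉ B₃ B₃' a₀ a₁ : ℝ} (hγ₀ : 0 < γ) (hγh : γ ≤ 1 / 2) (hε : 0 < ε₀) (hε' : 0 < ε₂₉) (hB : 0 ≤ B₃) (hB' : 0 ≤ B₃') (ha₀ : 0 < a₀) (ha₁ : 0 < a₁) (h15 : VariationalThm1RegSepCoP7M F 2 B₃ a₀ a₁) (hc : c ≤ F.L ^ j) (h9 : Gauge9RegSepTopStepR F 2 (fun ν K Ω => suppDomOfRecord F ν K Ω) (F.L ^ j) c B₃ B₃' a₀ a₁) {bl β' : ℝ} (hbox : BetaLowerH bl γ (betaOfRecord₁₃ F 2 (theta13OfThm1CCMW F 2 j γ ε₀ ε₂₉ B₃ B₃' a₀ a₁))) (hbox' : BetaUpperH β' γ (betaOfRecord₁₃ F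 2 (theta13OfThm1CCMW F 2 j γ ε₀ ε₂₉ B₃ B₃' a₀ a₁))) (hl : -bl * γ ^ 2 ≤ 3) (hβ' : β' * γ ^ 2 ≤ 3 / 4),
      ∀ βup β₀ : ℝ, ∃ γ₁₁ : ℝ, 0 < γ₁₁ ∧ ∀ w : WorldP, w.C = (datumOfRecord₁₃SepCoPH F 2 (Stage13HParams.ofHistoryBlind F 2 ⟨theta13OfThm1CCMW F 2 j γ ε₀ ε₂₉ B₃ B₃' a₀ a₁, ZrOfRecord₁₃ F 2 (theta13OfThm1CCMW F 2 j γ ε₀ ε₂₉ B₃ B₃' a₀ a₁)⟩) (N24_provisos₁₃SepCoPH_door_theta13OfThm1CCMW_of_gauge9TopStepR_of_betaBoxSignFree_allTorus hγ₀ hγh hε hε' hB hB' ha₀ ha₁ h15 hc h9 hbox hbox' hl hβ')).C →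
      w.βup = βup → w.β₀ = β₀ → w.γ ≤ γ₁₁ → ∀ P : B12.RunParams, (leavesP w P).b7 → (leavesP w P).b8 → (leavesP w P).b9 → (leavesP w P).b10 → (leavesP w P).b11 →
      (leavesP w P).smallCouplings → (leavesP w P).smallFieldInductive → (leavesP w P).flowControl →
        ∀ k, k < P.K → SLaw₁₃CoPH F 2 (Stage13HParams.ofHistoryBlind F 2 ⟨theta13OfThm1CCMW F 2 j γ ε₀ ε₂₉ B₃ B₃' a₀ a₁, ZrOfRecord₁₃ F 2 (theta13OfThm1CCMW F 2 j γ ε₀ ε₂₉ B₃ B₃' a₀ a₁)⟩) P k → TLaw₁₃CoPH F 2 (Stage13HParams.ofHistoryBlind F 2 ⟨theta13OfThm1CCMW F 2 j γ ε₀ ε₂₉ B₃ B₃' a₀ a₁, ZrOfRecord₁₃ F 2 (theta13OfThm1CCMW F 2 j γ ε₀ ε₂₉ B₃ B₃' a₀ a₁)⟩) P k)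
    (h12F : ∀ {j c : ℕ} {γ ε₀ ε₂₉ B₃ B₃' a₀ a₁ : ℝ} (hγ₀ : 0 < γ) (hγh : γ ≤ 1 / 2) (hε : 0 < ε₀) (hε' : 0 < ε₂₉) (hB : 0 ≤ B₃) (hB' : 0 ≤ B₃') (ha₀ : 0 < a₀) (ha₁ : 0 < a₁) (h15 : VariationalThm1RegSepCoP7M F 2 B₃ a₀ a₁) (hc : c ≤ F.L ^ j) (h9 : Gauge9RegSepTopStepR F 2 (fun ν K Ω => suppDomOfRecord F ν K Ω) (F.L ^ j) c B₃ B₃' a₀ a₁) {bl β' : ℝ} (hbox : BetaLowerH bl γ (betaOfRecord₁₃ F 2 (theta13OfThm1CCMW F 2 j γ ε₀ ε₂₉ B₃ B₃' a₀ a₁))) (hbox' : BetaUpperH β' γ (betaOfRecord₁₃ F 2 (theta13OfThm1CCMW F 2 j γ ε₀ ε₂₉ B₃ B₃' a₀ a₁))) (hl : -bl * γ ^ 2 ≤ 3) (hβ' : β' * γ ^ 2 ≤ 3 / 4),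
      ∃ lamW : ResidW F 2, (∀ P : B12.RunParams, B15Leaf (WOfRecord₁₃ F 2 (theta13OfThm1CCMW F 2 j γ ε₀ ε₂₉ B₃ B₃' a₀ a₁) lamW P)) ∧
      ∀ P : B12.RunParams, 1 ≤ P.K → lamW.kSel P < P.K)
    (hUVF : ∀ {j c : ℕ} {γ ε₀ ε₂₉ B₃ B₃' a₀ a₁ : ℝ} (hγ₀ : 0 < γ) (hγh : γ ≤ 1 / 2) (hε : 0 < ε₀) (hε' : 0 < ε₂₉) (hB : 0 ≤ B₃) (hB' : 0 ≤ B₃') (ha₀ : 0 < a₀) (ha₁ : 0 < a₁) (h15 : VariationalThm1RegSepCoP7M F 2 B₃ a₀ a₁) (hc : c ≤ F.L ^ j) (h9 : Gauge9RegSepTopStepR F 2 (fun ν K Ω => suppDomOfRecord F ν K Ω) (F.L ^ j) c B₃ B₃' a₀ a₁) {bl β' : ℝ} (hbox : BetaLowerH bl γ (betaOfRecord₁₃ F 2 (theta13OfThm1CCMW F 2 j γ ε₀ ε₂₉ B₃ B₃' a₀ a₁))) (hbox' : BetaUpperH β' γ (betaOfRecord₁₃ F 2 (theta13OfThm1CCMW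 F 2 j γ ε₀ ε₂₉ B₃ B₃' a₀ a₁))) (hl : -bl * γ ^ 2 ≤ 3) (hβ' : β' * γ ^ 2 ≤ 3 / 4),
      ∃ γ₁₃ : ℝ, 0 < γ₁₃ ∧ ∃ em ep : ℝ → ℝ, ∀ P : B12.RunParams, (genFlow (betaOfRecord₁₃ F 2 (theta13OfThm1CCMW F 2 j γ ε₀ ε₂₉ B₃ B₃' a₀ a₁)) P.g0).InInterval γ₁₃ P.K → ∀ k, k ≤ P.K → SLaw₁₃CoPH F 2 (Stage13HParams.ofHistoryBlind F 2 ⟨theta13OfThm1CCMW F 2 j γ ε₀ ε₂₉ B₃ B₃' a₀ a₁, ZrOfRecord₁₃ F 2 (theta13OfThm1CCMW F 2 j γ ε₀ ε₂₉ B₃ B₃' a₀ a₁)⟩) P k →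
      ∀ U : GaugeField (F.P P.K) k (SU 2),
        chiβOfRecord₁₃ F 2 (theta13OfThm1CCMW F 2 j γ ε₀ ε₂₉ B₃ B₃' a₀ a₁) P.K (gOfRecord₁₃ F 2 (theta13OfThm1CCMW F 2 j γ ε₀ ε₂₉ B₃ B₃' a₀ a₁) P) k U *
              Real.exp (-(1 / (gOfRecord₁₃ F 2 (theta13OfThm1CCMW F 2 j γ ε₀ ε₂₉ B₃ B₃' a₀ a₁) P k) ^ 2 * wilsonBGOfRecord F 2 (theta13OfThm1CCMW F 2 j γ ε₀ ε₂₉ B₃ B₃' a₀ a₁).εbg P k U)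
                - em (gOfRecord₁₃ F 2 (theta13OfThm1CCMW F 2 j γ ε₀ ε₂₉ B₃ B₃' a₀ a₁) P k) * (Fintype.card (Site (F.P P.K) k) : ℝ)) ≤ densOfRecord₁₃ F 2 (theta13OfThm1CCMW F 2 j γ ε₀ ε₂₉ B₃ B₃' a₀ a₁) P k U ∧
        densOfRecord₁₃ F 2 (theta13OfThm1CCMW F 2 j γ ε₀ ε₂₉ B₃ B₃' a₀ a₁) P k U ≤ Real.exp (ep (gOfRecord₁₃ F 2 (theta13OfThm1CCMW F 2 j γ ε₀ ε₂₉ B₃ B₃' a₀ a₁) P k) * (Fintype.card (Site (F.P P.K) k) : ℝ))) :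
    ∃ (θ : Stage13HParams F 2) (hP : θ.Provisos₁₃SepCoPH F 2) (w : WorldP), (θ.ZhUnity F 2 ∧ θ.SlotsNondegenerate₁₃ F 2) ∧ θ.Admissible F 2 ∧
      (∃ (θ' : Stage13HParams F 2) (h' : θ'.Provisos₁₃SepCoPH F 2), θ'.Admissible F 2 ∧
      datumOfRecord₁₃SepCoPH F 2 θ hP = datumOfRecord₁₃SepCoPH F 2 θ' h' ∧ w.C = (datumOfRecord₁₃SepCoPH F 2 θ hP).C ∧ (0 < w.γ ∧ w.γ ≤ θ'.γ) ∧
      w.L = (θ'.L : ℝ) ∧ ∀ P : B12.RunParams, w.up P = upOfRecord₅CS F 2 (θ'.toStage5₁₃CoPH F 2) P) ∧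
      (∀ P : B12.RunParams, Nodes (leavesP w P)) ∧ PrintedUV3V 2 θ.L ∧
      ∃ lam : ResidW F 2, (∀ P : B12.RunParams, 1 ≤ P.K → lam.kSel P < P.K) ∧
        ∀ P : B12.RunParams, lam.kSel P < P.K → ((leavesP w P).rBasicStep ↔ B15Leaf (WOfRecord₁₃ F 2 θ.toStage13Params lam P)) := by
  obtain ⟨B₃, a₀, a₁, hB₃, ha₀, ha₁, h8⟩ := h1F
  have hL0 : (0 : ℝ) < (F.L : ℝ) := by exact_mod_cast lt_trans Nat.zero_lt_one F.hL.2
  have hBpos : (0 : ℝ) < B₃ := lt_of_lt_of_le (mul_pos two_pos (pow_pos hL0 2)) hB₃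
  obtain ⟨j, c, B₉, a₁', hc, hB9, ha₁', ha₁'le, h9⟩ := gauge9Supplier_of_prop6MemberP F h2PF B₃ a₀ a₁ hB₃ ha₀ ha₁ h8
  have h15 : VariationalThm1RegSepCoP7M F 2 B₃ a₀ a₁' := variationalThm1RegSepCoP7M_of_prop8TopStep hBpos (h8.of_le le_rfl ha₁'le)
  obtain ⟨γ₀, ε₀, ε₂₉, β', hγ0, hε, hε', hlow, hup⟩ := h3A'F j c B₃ B₉ a₀ a₁' hc hB₃ hB9 ha₀ ha₁' h15 h9
  obtain ⟨γ, hγpos, hγh, hl, hu, hlow', hup'⟩ := windowLetters_of_absBetaBoxH hγ0 hlow hup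
  have hloW := betaLowerH_theta13OfThm1CCMW_of_half (F := F) (N := 2) (j := j) (ε₀ := ε₀) (ε₂₉ := ε₂₉) (B₃ := B₃) (B₃' := B₉) (a₀ := a₀) (a₁ := a₁') hγh hlow'
  have hupW := betaUpperH_theta13OfThm1CCMW_of_half (F := F) (N := 2) (j := j) (ε₀ := ε₀) (ε₂₉ := ε₂₉) (B₃ := B₃) (B₃' := B₉) (a₀ := a₀) (a₁ := a₁') hγh hup'
  exact N24_nodesAtSomeRecordS₁₃SepCoPH_worldBuilt_childrenSplit_theta13OfThm1CCMW_of_gauge9TopStepR_of_betaBoxSignFree_allTorus_door hγpos hγh hε hε' hBpos.le hB9.le ha₀ ha₁' h15 hc h9 hloW hupW hl hu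
    (h05F hγpos hγh hε hε' hBpos.le hB9.le ha₀ ha₁' h15 hc h9 hloW hupW hl hu) (h06F hγpos hγh hε hε' hBpos.le hB9.le ha₀ ha₁' h15 hc h9 hloW hupW hl hu) h07 h08 (h09F hγpos hγh hε hε' hBpos.le hB9.le ha₀ ha₁' h15 hc h9 hloW hupW hl hu) (h09TF hγpos hγh hε hε' hBpos.le hB9.le ha₀ ha₁' h15 hc h9 hloW hupW hl hu) (h10F hγpos hγh hε hε' hBpos.le hB9.le ha₀ ha₁' h15 hc h9 hloW hupW hl hu) (h11F hγpos hγh hε hε' hBpos.le hB9.le ha₀ ha₁' h15 hc h9 hloW hupW hl hu) (h12F hγpos hγh hε hε' hBpos.le hB9.le ha₀ ha₁' h15 hc h9 hloW hupW hl hu) (hUVF hγpos hγh hε hε' hBpos.le hB9.le ha₀ ha₁' h15 hc h9 hloW hupW hl hu)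

end Summit.QuantumFields.YangMills.BalabanUVNodes.N24K1OfStubsV19ChildrenSplitWorldBuilt

end
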